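import Literature.Topology.FourManifolds.SimplifiedBrokenLefschetzFibration
import Literature.Topology.FourManifolds.SimplyConnectedEulerCharacteristic
import Literature.AlgebraicTopology.SingularHomology.EulerCharacteristicTriple
import Literature.Topology.Immersions.SurjectiveDifferentialOpen
import Literature.Geometry.Manifold.OpenSubmanifoldMFDeriv
import Literature.Topology.FourManifolds.RegularLevelSplitting
import Literature.Topology.FourManifolds.BoundaryOrientation
import Literature.Topology.FourManifolds.SpinProofs
import Literature.Topology.FourManifolds.IntersectionLatticeOrientationProofs
import Literature.AlgebraicTopology.SingularHomology.CompactManifoldFiniteness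
import Literature.AlgebraicTopology.SingularHomology.FundamentalClassExistence
import Literature.AlgebraicTopology.SingularHomology.FundamentalClassProofs
import Literature.AlgebraicTopology.SingularHomology.CellsAttachmentEuler
import Literature.Geometry.Manifold.CircleSubmersionConnectedFibres
import HarnessLib

/-!
# The genus-one rung (Hayano 2011, Cor. 4.11 at `H₂ = 0`): reduction to the Euler count and the
# Lefschetz-free classification

Topic `Literature/Topology/FourManifolds`, the `…Proofs` sibling of
`SimplifiedBrokenLefschetzFibration.lean`.  That file carries two named facts about simplified
broken Lefschetz fibrations (SBLFs, `IsSimplifiedBrokenLefschetzFibration o f L h`):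

* `card_eq_four_mul_of_sblf_of_homotopyEquiv_sphere_four` — Baykur 2012, Lemma 7 (*"If `X`
  admits a genus `g` SBLF with `k` Lefschetz singularities, then […] `e(X) = 6 - 4g + k`"*) read
  on a homotopy 4-sphere (`e = 2`): a genus-`(h + 1)` SBLF of a homotopy 4-sphere has exactly
  `4h` Lefschetz points;
* `nonempty_diffeomorph_sphere_four_of_sblf_genus_one_noLefschetz` — Baykur–Kamada 2015,
  Lemma 11 / Thm. 13 (second case) with Cor. 14, equally Hayano 2011, Thm. 4.2 / Main Theorem B
  at `r = 0`: a closed simply connected 4-manifold with a genus-1 SBLF WITHOUT Lefschetz points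
  is `S⁴`.

The genus-one rung itself — Hayano 2011, Cor. 4.11 (*"Simply connected 4-manifolds with positive
definite intersection form cannot admit any genus-1 SBLF structures except `S⁴`"*) in the case
`H₂(X; ℤ) = 0`: a closed simply connected smooth 4-manifold with `H₂ = 0` carrying a genus-1 SBLF
with non-empty round locus is diffeomorphic to `S⁴` — was at first recorded there as a third named
fact, `nonempty_diffeomorph_sphere_four_of_sblf_genus_one`; being exactly the conjunction of the
two displayed facts (this file's `nonempty_diffeomorph_sphere_four_of_sblf_genus_one_of`), it was
merged into them (2026-08-17) and now lives only as that conditional THEOREM.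

Everything here is PROVED; no definition and no named fact is introduced.  The file records the
kernel-checked reduction of the rung to the two facts — the architecture of the published
argument (Hayano proves Cor. 4.11 through Thm. 4.2 / Thm. 4.10 and the Hurwitz-system normal form
Thm. 3.11; Baykur–Kamada classify the Lefschetz-free case in §5 and count Euler characteristics
with Baykur 2012, Lemma 7 — compare Baykur 2012, Remark 14 for exactly this use of the count):

1. a closed simply connected 4-manifold `X` with `H₂(X; ℤ) = 0` is a homotopy 4-sphere — the
   tree's DISCHARGED criterion `spc4.S10`, `nonempty_homotopyEquiv_sphere_four_iff_holds`
   (Freedman–Quinn 1990, §10.1; Poincaré duality, Hurewicz, Milnor's CW type, all proved);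
2. so a genus-1 SBLF on `X` has `4 · 0 = 0` Lefschetz points (the Euler count), i.e. `L = ∅`;
3. and the Lefschetz-free classification concludes.

* `relEuler_eq_two_of_isZero_singularHomology_two`, `relEuler_eq_two_of_homotopyEquiv_sphere_four`
  — **`χ(X) = 2`** for a closed simply connected 4-manifold with `H₂(X; ℤ) = 0`, resp. for a smooth
  homotopy 4-sphere (the case `b₂ = 0` of Kirby 1989, Ch. II §1 `χ = 2 + b₂`, the tree's PROVED
  `relEuler_eq_two_add_finrank_singularHomology_two_of_simplyConnectedSpace`): the first step of
  any proof of the Euler count `card_eq_four_mul_of_sblf_of_homotopyEquiv_sphere_four` from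
  Baykur's identity `χ(X) = 6 - 4g + k` for the tree's `relEuler`.
* `nonempty_diffeomorph_sphere_four_of_sblf_genus_one_of` — **Hayano's Cor. 4.11 at `H₂ = 0`
  from the two facts**, stated in full (every closed simply connected `X : Type` with
  `H₂(X; ℤ) = 0` carrying a genus-1 SBLF with non-empty round locus is diffeomorphic to `S⁴`);
  once `card_eq_four_mul_of_sblf_of_homotopyEquiv_sphere_four_holds` and
  `nonempty_diffeomorph_sphere_four_of_sblf_genus_one_noLefschetz_holds` exist, feeding them in
  makes it unconditional.  (The summit side,
  `Summits/SmoothPoincare4/SmoothPoincare4/Theorems/SblfDescentRungOne.lean`, closes its route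
  item `RungOne` from the same two facts directly; here `spc4.S10` is fed discharged.)

* `surjective_fderiv_foldNormalForm_iff`, `surjective_mfderiv_iff_of_fold_chart`,
  `mfderiv_ne_zero_of_fold_chart` — **the critical set of the indefinite fold normal form
  `(t, x₁, x₂, x₃) ↦ (t, x₁² + x₂² - x₃²)` is the `t`-axis** (Hayano 2011, Def. 2.1 (4):
  *"`Z = {(t, 0, 0, 0)}`"*), transferred through the chart differentials: in a fold chart of
  `f` the critical points are exactly the points of the axis, and `df ≠ 0` there; hence
  (`IsSimplifiedBrokenLefschetzFibration.exists_chart_round`) every round point of an SBLF has a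
  smooth chart in which the round locus is the axis and which contains no Lefschetz point, and
  (`….apply_ne_apply_of_mem_of_round`) Lefschetz values avoid the round image — the local
  structure of the round locus with which the Euler count starts (groundwork, PROVED).

* `isOpen_setOf_surjective_mfderiv_of_contMDiff` — **the submersive locus of a `C^∞` map between
  manifolds is open** (Hirsch 1976, Ch. 1 §3), reduced to the tree's Euclidean-target
  `Literature.Topology.Immersions.isOpen_setOf_surjective_mfderiv` on the open submanifold
  `f⁻¹(dom ψ)` through a chart `ψ` of the target; `contDiff_lefschetzNodeMap`,
  `fderiv_lefschetzNodeMap_apply`, `surjective_fderiv_lefschetzNodeMap_iff` — **the node `z₁ z₂`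
  is a submersion exactly off the origin**; `LefschetzChart.surjective_mfderiv_iff`,
  `LefschetzChart.eq_of_not_surjective_mfderiv` — in a Lefschetz chart the centre is the only
  critical point.  Hence, for an SBLF `f` (`IsSimplifiedBrokenLefschetzFibration.…`): the critical
  set is closed (`isClosed_setOf_not_surjective`), Lefschetz points are isolated in it
  (`exists_isOpen_forall_eq_of_mem`), **the round locus is closed, and compact on a compact `X`**
  (`isClosed_round`, `isCompact_round`), its image is compact and connected
  (`isCompact_image_round`, `isConnected_image_round`), the critical image is the round image plus
  the Lefschetz values (`image_setOf_not_surjective_eq`), and **the regular values form an open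
  set** (`setOf_regularValue_eq`, `isOpen_setOf_regularValue`) — the topological input for
  Ehresmann's theorem off the critical image and for the Schoenflies normalisation of the round
  image (groundwork for the Euler count, PROVED).

* `exists_isSmoothEmbedding_range_eq_preimage` — **the regular value theorem between manifolds**
  (Hirsch 1976, Ch. 1 §3 Thm. 3.2): a regular fibre of a `C^∞` map `M → N` (models `ℝⁿ`, `ℝᵏ`,
  `n = m + k`) is the image of a `C^∞` embedding of an `m`-manifold, reduced to the tree's
  Euclidean-target `exists_regularPreimage` through a chart of `N` on the open submanifold of
  regular points; hence (`IsSimplifiedBrokenLefschetzFibration.exists_isSmoothEmbedding_range_eq_fibre`)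
  **a regular fibre of an SBLF on a closed 4-manifold is an embedded closed connected surface**
  — the surface whose genus the fibre clauses read (groundwork for the Euler count, PROVED).

* `exists_orientable_surface_range_eq_preimage` — **a regular fibre of a smooth map from a
  4-manifold to a surface is an embedded surface, orientable when the 4-manifold is** (Milnor
  1963, Thm. 3.1; Hirsch 1976, §4.4): in the chart `ψ` at the regular value the fibre is cut out
  in two steps, `Y = ∂{ψ₀ ∘ f ≤ c₀}` (the tree's `RegularSublevel` with its boundary-manifold
  structure, orientable by `RegularSublevel.isOrientable` and `isOrientable_boundary`) and
  `F = ∂{ψ₁ ∘ f ≤ c₁} ⊆ Y` (`c₁` is a regular level on `Y` because `T Y = ker d(ψ₀ ∘ f)` and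
  `d(ψ ∘ f)` is onto); `finRelHomology_and_relEuler_of_isOrientable_surface` — **`χ(F) = 2 - b₁(F)`
  for a closed connected smoothly orientable surface** (Hatcher Thm. 3.26, via the tree's
  `isOrientableOver_int_of_isOrientable_holds` and fundamental class); hence
  (`IsSimplifiedBrokenLefschetzFibration.exists_oriented_surface_fibre`, `relEuler_eq_of_genus_clause`)
  **every regular fibre of an SBLF on a closed oriented 4-manifold is a closed connected
  orientable surface `F ≃ₜ f⁻¹(y)` with `χ(F) = 2 - rank H₁(f⁻¹(y); ℤ) = 2 - 2g`**, `g = h + 1` or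
  `h` by the genus clauses — the fibre Euler characteristics of Baykur's count (PROVED).

* `isLocallyTrivialFibration_restrictPreimage`, `isFibreBundleWith_restrictPreimage` —
  **Ehresmann off the critical image**: a `C^∞` map `f : X → S²` from a closed 4-manifold
  restricted over an open set `W` of regular values is a locally trivial fibration (the tree's
  PROVED `ehresmann_fibration_holds`, Bröcker–Jänich (8.12), on the proper submersion between the
  open submanifolds `f⁻¹(W) → W`), and over a preconnected such `W` a fibre bundle
  (`IsFibreBundleWith`) with fibre `f⁻¹(y₀)`, `y₀ ∈ W` (`isFibreBundleWith_of_fibre_homeomorph`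
  changes the model fibre along a homeomorphism) — the surface bundles over the two discs of
  Baykur's count (PROVED).

Status of the two inputs (2026-08-17).  **The Euler count**
`card_eq_four_mul_of_sblf_of_homotopyEquiv_sphere_four` (`χ(X) = 2 - 4h + k`) is DISCHARGED:
`card_eq_four_mul_of_sblf_of_homotopyEquiv_sphere_four_holds` in
`SimplifiedBrokenLefschetzEulerCount.lean`, along the Morse-theoretic reading of Baykur's proof
prepared here and in `SimplifiedBrokenLefschetzMorseCharts.lean` (Hessians of `ℓ ∘ f` in fold and
Lefschetz charts), `SimplifiedBrokenLefschetzRoundImage.lean` (the round image is an embedded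
circle; Schoenflies normalisation to the equator; transport of the SBLF structure),
`SlabMorseCount.lean` (`χ` of a slab between regular levels = signed Morse count),
`SimplifiedBrokenLefschetzCaps.lean` (`χ` of the polar caps and of levels) and
`SimplifiedBrokenLefschetzHeight.lean` (critical points and indices of a tilted linear height
`Λ ∘ f`; the fold contributions cancel between `Λ` and its mirror `ε ↦ -ε`, so no coorientation
of the round image is needed): `2 χ(X) = (2 - 2h) + (2 - 2(h + 1)) + … ` twice gives `k = 4h`.
**The Lefschetz-free classification** `nonempty_diffeomorph_sphere_four_of_sblf_genus_one_noLefschetz`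
(Baykur–Kamada 2015, Lemma 11 / Cor. 14; Hayano 2011, Thm. 4.2; Auroux–Donaldson–Katzarkov 2005,
§8.2 Ex. 1: *"`X_- ∪ W ≃ S¹ × B³`, and by gluing `X_+ = D² × S²` along the boundary we obtain
`X' ≃ S⁴`"*) remains a named fact.  The tree reduces it
(`nonempty_diffeomorph_sphere_four_of_sblf_genus_one_noLefschetz_of_laudenbachPoenaru_of_polarHandlebody`,
`SimplifiedBrokenLefschetzSphereSideTube.lean`, with `SphereFourGenusOneSplitting.lean`,
`SimplifiedBrokenLefschetzSides.lean`, `SimplifiedBrokenLefschetzSidesGenus.lean`) to exactly two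
inputs: (LP) the Laudenbach–Poénaru extension fact `exists_diffeomorph_comp_incl_eq` (every
self-diffeomorphism of the boundary of an orientable `4`-dimensional `1`-handlebody extends; its
`k = 0` instance is Cerf's `Γ₄ = 0`, `cerf_diffeomorph_sphere_three_extends_ball_of_exists_diffeomorph_comp_incl_eq`),
which every printed proof uses in the form "the gluing of `D² × S²` to `S¹ × B³` does not
matter"; and (K) the statement that the complement `K = {⟪v, f⟫ ≥ -1/2}` of the sphere-side tube
(ADK's `X_- ∪ W`) is a `(1,1)`-handlebody, `HasHandleDecomposition 3 K (handleCount 1 1)`.  On (K):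
a boundary-adapted Morse function on `K` of the form `F ∘ f` plus a small perturbation supported
near one fibre has at least four critical points — `F` restricted to the disc `f(K)` has an
interior minimum `w₀`, whose fibre must be perturbed (`≥ 2` critical points for a sphere fibre,
`≥ 4` for a torus fibre), and `F` restricted to the round image has `≥ 2` critical points, of
Morse index (tangential index) `+ 1` when `F` increases into the higher side there and `+ 2`
otherwise (`nondegenerate_and_morseIndex_comp_of_fold_chart`, `SimplifiedBrokenLefschetzMorseCharts.lean`;
the side is read by `mul_fderiv_symm_pos_of_fold_chart`, `SimplifiedBrokenLefschetzRoundSlicesIndex.lean`):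
index sets `{0, 2} ∪ {1, 3}` for `w₀` on the sphere side and `{0, 1, 1, 2} ∪ {2, 3}` for `w₀` on
the torus side.  Reaching `(1,1)` from `{0, 1, 2, 3}` is one application of Milnor's First
Cancellation Theorem (PROVED in the tree: `Cobordism.Milnor1965_firstCancellation_slab_holds`,
`HCobordismTheoremProofs.lean`) to the pair (top of the fibre over `w₀`, far round point), whose
single-transverse-intersection hypothesis is a statement about the sweep of the vanishing cycles
of the torus fibres across the higher side — the geometric content of ADK's sentence.  The
transverse `3`-dimensional slices through the round points (index-`1` cobordisms from the lower
to the higher side) are in `SimplifiedBrokenLefschetzRoundSlices.lean`,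
`SimplifiedBrokenLefschetzRoundSlicesIndex.lean`.  No statement of this file takes the target
fact itself as a hypothesis.

On (LP) (addendum, 2026-08-17).  Already its instance `k = 1` — every self-diffeomorphism of
`S¹ × S²` extends over `S¹ × B³` — gives `Γ₄ = 0`: a `φ ∈ Diff⁺(S³)` isotoped to have support in a
`3`-ball `U` may be implanted in `S¹ × S² ⊇ U`, and regluing `S⁴ = (S¹ × B³) ∪ (S² × D²)` by
`φ|_U ∪ id` is the twisted sphere `Σ_φ = S⁴ # Σ_φ` (regluing along a hypersurface by a
diffeomorphism supported in `U` depends only on `U`); so weakening (LP) to `k = 1` does not leave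
Cerf's theorem
(the tree's leaf `cerf_diffeomorph_sphere_three_extends_ball`, reduced in `CerfDiscConnected.lean`
to Cerf's (4) "`Diff⁺ D³` is connected").  What the sphere side needs WITHOUT (LP) is in the tree:
if `K ≅ S¹ × B³` by a diffeomorphism which on `∂K` carries the sphere fibre over each point of the
level circle onto a slice `{θ} × ∂B³`, the gluing map of `S² × S¹` is `(y, θ) ↦ (g_θ y, θ)` for a
smooth loop `g` in `Diff(S²)` (up to a diffeomorphism of the circle factor); `g₀` extends over `B³`
(`Diffeomorph.isDiffeotopicToId_or_isDiffeotopic_sphereReflection_two`, Smale 1959 at `π₀`,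
`SmaleDiffDisc.lean`), the based loop `g_θ g₀⁻¹` deforms through based loops to a loop of linear
isometries `A_θ` (`exists_loopHomotopy_frameLoop_two`, `SphereDiffeoLoops.lean`: Smale's theorem in
families, Cerf 1968 App. §5 Cor. 2, `π₁ SO(3) ↠ π₁ Diff S²`), isotopic gluing maps give
diffeomorphic gluings (`nonempty_diffeomorph_of_isBoundaryGluing_of_isSmoothlyIsotopic_holds`), and
`(θ, x) ↦ (θ, A_θ x)` is a diffeomorphism of `S¹ × B³` extending the new gluing map
(`IsBoundaryGluing.comp_diffeomorph`, `SphereFourSplitting.isBoundaryGluing_levelSphere`) — no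
knowledge of `π₁ SO(3)` or of Gluck twists is used.  The torus side is where such a fibred
recognition of `K` costs: the round cobordism is the mapping torus of a LEVEL-PRESERVING
diffeomorphism `μ` of the `3`-dimensional page `f⁻¹(meridian arc)` (an elementary index-`1`
cobordism `S² ⇝ T²`; `μ` is the return map of any lift of the rotation of the base, lifts existing
through the fold points), and `μ` normalises, by free-end path contractions, the rescaling
`s⁻¹ μ(s ·)` at the critical point and `π₀` of `Diff(S²)` and of `Diff(S¹ × I rel ∂)`, to the twist
by a loop `ℓ` in `Diff₀(T²)` supported in the torus collar, i.e. `K ≅ (T² × D²) ∪_ℓ (S¹ × page)`.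
Since `Diff₀(T²) ≅ T² × (Diff₀(T²) ∩ Diff(T², pt))` canonically (translations), `[ℓ]` has a part in
`π₁(T²) = ℤ²` — the rotation number along the vanishing cycle (absorbed by re-coordinatising the
round handle) and the transverse winding `n` of the vanishing cycles, with `π₁(X) = ℤ/n`, the models
being Pao's `L_n` (Hayano 2011, Thm. 4.2 and Rem. 4.3; Baykur–Kamada 2015, Thm. 13), `L_{±1} = S⁴` —
and a part in `Π = π₁(Diff₀(T²) ∩ Diff(T², pt))`, which no freedom of the construction changes and
which extends over neither piece.  A Laudenbach–Poénaru-free discharge along these lines therefore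
needs `Π = 0`, i.e. the Earle–Eells theorem `Diff₀(T²) ≃ T²` at `π₁` (Earle–Eells 1969; Gramain
1973, Thm. 1), which is not in the tree (its `π₀` companion, faithfulness of `Mod(T²) → SL(2, ℤ)`,
is the hypothesis (F) of `HandlebodyKernelExtensionGenusOne.lean`).  In short: the fact is one of
{Cerf's (4), Earle–Eells for `T²`} away, plus bricks of the size of those already here.

## References

* K. Hayano, *On genus-1 simplified broken Lefschetz fibrations*, Algebr. Geom. Topol. 11 (2011)
  1267–1322 (arXiv:1012.4049), Thm. 3.11, Thm. 4.2, Thm. 4.10, Cor. 4.11, Main Theorem B.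
  [Hayano2011]
* R. İ. Baykur, *Broken Lefschetz fibrations and smooth structures on 4-manifolds*, Geom. Topol.
  Monogr. 18 (2012) 9–34 (arXiv:1205.5439), Lemma 7 and Remark 14. [Baykur2012]
* R. İ. Baykur, S. Kamada, *Classification of broken Lefschetz fibrations with small fiber
  genera*, J. Math. Soc. Japan 67 (2015) 877–901 (arXiv:1010.5814), §5, Lemma 11, Thm. 13,
  Cor. 14. [BaykurKamada2015]
* M. H. Freedman, F. Quinn, *Topology of 4-Manifolds*, PMS 39 (1990), §10.1. [FreedmanQuinnPMS1990]
* R. C. Kirby, *The Topology of 4-Manifolds*, LNM 1374 (1989), Ch. II §1 (`χ = 2 + b₂`). [Kirby1989]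
* F. Laudenbach, V. Poénaru, *A note on 4-dimensional handlebodies*, Bull. Soc. Math. France 100
  (1972) 337–344. [LaudenbachPoenaruBSMF1972]
* J. Cerf, *Sur les difféomorphismes de la sphère de dimension trois (Γ₄ = 0)*, LNM 53 (1968),
  Ch. I §2, Appendice §5 (Thm. 4, Cor. 2). [CerfDiffeoSphere1968]
* S. Smale, *Diffeomorphisms of the 2-sphere*, Proc. Amer. Math. Soc. 10 (1959) 621–626. [Smale1959]
* C. J. Earle, J. Eells, *A fibre bundle description of Teichmüller theory*, J. Differential
  Geometry 3 (1969) 19–43 (the torus: `Diff₀(T²) ≃ T²`). [EarleEells1969]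
* A. Gramain, *Le type d'homotopie du groupe des difféomorphismes d'une surface compacte*, Ann.
  Sci. École Norm. Sup. (4) 6 (1973) 53–66, Thm. 1. [Gramain1973]
-/

noncomputable section

open scoped Manifold ContDiff ContinuousMap Topology
open CategoryTheory Limits Set Function
open Literature.AlgebraicTopology.SingularHomology

namespace Literature.Topology.FourManifolds

universe u

/-! ### The Euler characteristic of a homotopy 4-sphere -/

/-- **`χ(X) = 2` for a closed simply connected 4-manifold with `H₂(X; ℤ) = 0`.**  For a compact
Hausdorff simply connected topological 4-manifold `X` with `H₂(X; ℤ) = 0` the Euler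
characteristic `relEuler ℤ ℤ X ∅ = Σ_j (-1)ʲ rank_ℤ H_j(X; ℤ)` equals `2` — the case `b₂ = 0` of
`χ(X) = 2 + rank H₂(X; ℤ)` (Kirby 1989, Ch. II §1, p. 20; Gompf–Stipsicz 1999, §1.2; the tree's
PROVED `relEuler_eq_two_add_finrank_singularHomology_two_of_simplyConnectedSpace`).  With
Baykur's count `χ(X) = 2 + k` for a genus-1 SBLF with `k` Lefschetz singularities (Baykur 2012,
Lemma 7) this forces `k = 0`. [cite: Kirby1989, Ch. II §1, p. 20] -/
theorem relEuler_eq_two_of_isZero_singularHomology_two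
    {X : Type u} [TopologicalSpace X] [T2Space X] [CompactSpace X]
    [ChartedSpace (EuclideanSpace ℝ (Fin 4)) X] [SimplyConnectedSpace X]
    (hX : IsZero (singularHomology ℤ ℤ X 2)) : relEuler ℤ ℤ X ∅ = 2 := by
  rw [relEuler_eq_two_add_finrank_singularHomology_two_of_simplyConnectedSpace,
    finrank_eq_zero_of_isZero hX]
  simp

/-- **`χ(X) = 2` for a smooth homotopy 4-sphere** (`e(X) = e(S⁴) = 2`; Kirby 1989, Ch. II §1 with
Freedman–Quinn 1990, §10.1): a Hausdorff second-countable `C^∞` 4-manifold `X : Type` homotopy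
equivalent to `S⁴` is compact (`compactSpace_of_homotopyEquiv_sphere_four_holds`), simply
connected with `H₂(X; ℤ) = 0` (`simplyConnectedSpace_and_isZero_of_homotopyEquiv`, the easy
direction of `spc4.S10`), hence has `relEuler ℤ ℤ X ∅ = 2`.  This is the left-hand side of
Baykur's count `2 = e(X) = 6 - 4(h + 1) + k` behind
`card_eq_four_mul_of_sblf_of_homotopyEquiv_sphere_four`. [cite: Kirby1989, Ch. II §1, p. 20] -/
theorem relEuler_eq_two_of_homotopyEquiv_sphere_four
    {X : Type} [TopologicalSpace X] [T2Space X] [SecondCountableTopology X]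
    [ChartedSpace (EuclideanSpace ℝ (Fin 4)) X] [IsManifold (𝓡 4) ∞ X]
    (e : X ≃ₕ Metric.sphere (0 : EuclideanSpace ℝ (Fin 5)) 1) : relEuler ℤ ℤ X ∅ = 2 := by
  haveI : CompactSpace X := compactSpace_of_homotopyEquiv_sphere_four_holds X e
  obtain ⟨_, hH₂⟩ := simplyConnectedSpace_and_isZero_of_homotopyEquiv e
  exact relEuler_eq_two_of_isZero_singularHomology_two hH₂

/-! ### Hayano's Cor. 4.11 at `H₂ = 0` from the Euler count and the Lefschetz-free classification -/

/-- **Hayano's Cor. 4.11 for homotopy 4-spheres (`H₂ = 0`), from the Euler count and the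
Lefschetz-free genus-one classification.**  Hayano 2011, Cor. 4.11, verbatim: *"Simply connected
4-manifolds with positive definite intersection form cannot admit any genus-1 SBLF structures
except `S⁴`."* (there `M` is a closed connected oriented smooth 4-manifold and the SBLFs have
non-empty round singular locus as in his Main Theorems; `s > 0` in the Hurwitz system
`S_r T(n₁,…,n_s)` of Thm. 3.11 forces an `S² × S²` or `S² ×~ S²` summand by Thm. 4.10, and
`s = 0` puts `M` in the list of Thm. 4.2, whose only simply connected positive definite member is
`S⁴`); independently Baykur–Kamada 2015, Lemma 11 with Cor. 14, and Baykur 2012, p. 18 (only `S⁴`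
among homotopy 4-spheres has broken genus one).  LEAN READING — the special case in which the
intersection form is the zero form, GIVEN the named facts
`card_eq_four_mul_of_sblf_of_homotopyEquiv_sphere_four` (Baykur 2012, Lemma 7 on a homotopy
4-sphere: a genus-`(h + 1)` SBLF of a homotopy 4-sphere has `4h` Lefschetz points) and
`nonempty_diffeomorph_sphere_four_of_sblf_genus_one_noLefschetz` (Baykur–Kamada 2015, Lemma 11 /
Thm. 13 with Cor. 14; Hayano 2011, Thm. 4.2: a closed simply connected 4-manifold with a genus-1
SBLF without Lefschetz points is `S⁴`): every Hausdorff, second countable, compact, simply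
connected `C^∞` 4-manifold `X : Type` with `H₂(X; ℤ) = 0` that carries a smooth orientation `o`
and a genus-1 simplified broken Lefschetz fibration `f : X → S²` with non-empty round locus
(`IsSimplifiedBrokenLefschetzFibration o f L 0` for some finite `L`) is diffeomorphic to the unit
sphere `S⁴ ⊆ ℝ⁵`.  Proof: `X` is a homotopy 4-sphere by the tree's discharged criterion
`nonempty_homotopyEquiv_sphere_four_iff_holds` (`spc4.S10`, Freedman–Quinn 1990, §10.1), so the
SBLF has `4 · 0 = 0` Lefschetz points, `L = ∅`, and the classification applies.  CONDITIONAL on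
the two displayed facts (feeding in their discharges makes it Hayano's Cor. 4.11 at `H₂ = 0`
outright).  This statement was at first recorded as a named fact of its own,
`nonempty_diffeomorph_sphere_four_of_sblf_genus_one`; being the conjunction of the two displayed
facts it was merged into them (2026-08-17) and survives as this theorem.
[cite: Hayano2011, Cor. 4.11] -/
theorem nonempty_diffeomorph_sphere_four_of_sblf_genus_one_of
    (hA : card_eq_four_mul_of_sblf_of_homotopyEquiv_sphere_four)
    (hB : nonempty_diffeomorph_sphere_four_of_sblf_genus_one_noLefschetz)
    (X : Type) [TopologicalSpace X] [T2Space X] [SecondCountableTopology X] [CompactSpace X]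
    [ChartedSpace (EuclideanSpace ℝ (Fin 4)) X] [IsManifold (𝓡 4) ∞ X] [SimplyConnectedSpace X]
    (hX : IsZero (singularHomology ℤ ℤ X 2))
    (hf : ∃ (o : SmoothOrientation (𝓡 4) X) (f : X → Metric.sphere (0 : EuclideanSpace ℝ (Fin 3)) 1)
      (L : Finset X), IsSimplifiedBrokenLefschetzFibration o f L 0) :
    Nonempty (Diffeomorph (𝓡 4) (𝓡 4) X (Metric.sphere (0 : EuclideanSpace ℝ (Fin 5)) 1) ∞) := by
  obtain ⟨o, f, L, hf⟩ := hf
  -- `X` is a homotopy 4-sphere (`spc4.S10`, discharged in the tree)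
  obtain ⟨e⟩ := (nonempty_homotopyEquiv_sphere_four_iff_holds X).mpr ⟨inferInstance, hX⟩
  -- the Euler count empties the Lefschetz critical set
  obtain rfl : L = ∅ := Finset.card_eq_zero.mp (by simpa using hA X e o f L 0 hf)
  exact hB X ⟨o, f, hf⟩

/-! ### The differential of the indefinite fold normal form -/

section FoldModel

/-- The fold normal form `(t, x₁, x₂, x₃) ↦ (t, x₁² + x₂² - x₃²)` is smooth. [folklore] -/
theorem contDiff_foldNormalForm :
    ContDiff ℝ ∞ (fun v : EuclideanSpace ℝ (Fin 4) =>
      (WithLp.toLp 2 ![v 0, v 1 ^ 2 + v 2 ^ 2 - v 3 ^ 2] : EuclideanSpace ℝ (Fin 2))) := by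
  refine contDiff_euclidean.2 fun i => ?_
  fin_cases i
  · simp only [Fin.zero_eta, Matrix.cons_val_zero]
    fun_prop
  · simp only [Fin.mk_one, Matrix.cons_val_one, Matrix.cons_val_zero]
    fun_prop

/-- Components of the differential of the fold normal form: `(dF_v w)₀ = w₀` and
`(dF_v w)₁ = 2 (v₁ w₁ + v₂ w₂ - v₃ w₃)`. [folklore] -/
theorem fderiv_foldNormalForm_apply (v w : EuclideanSpace ℝ (Fin 4)) :
    (fderiv ℝ (fun v : EuclideanSpace ℝ (Fin 4) =>
      (WithLp.toLp 2 ![v 0, v 1 ^ 2 + v 2 ^ 2 - v 3 ^ 2] : EuclideanSpace ℝ (Fin 2))) v w) 0 = w 0 ∧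
    (fderiv ℝ (fun v : EuclideanSpace ℝ (Fin 4) =>
      (WithLp.toLp 2 ![v 0, v 1 ^ 2 + v 2 ^ 2 - v 3 ^ 2] : EuclideanSpace ℝ (Fin 2))) v w) 1 =
      2 * (v 1 * w 1 + v 2 * w 2 - v 3 * w 3) := by
  set F : EuclideanSpace ℝ (Fin 4) → EuclideanSpace ℝ (Fin 2) := fun v =>
    WithLp.toLp 2 ![v 0, v 1 ^ 2 + v 2 ^ 2 - v 3 ^ 2] with hF
  have hD : HasFDerivAt F (fderiv ℝ F v) v :=
    ((contDiff_foldNormalForm.differentiable (by simp)) v).hasFDerivAt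
  have hcomp := (hasFDerivWithinAt_univ.2 hD)
  rw [hasFDerivWithinAt_euclidean] at hcomp
  -- component 0
  let p : Fin 4 → (EuclideanSpace ℝ (Fin 4) →L[ℝ] ℝ) := fun i => EuclideanSpace.proj (𝕜 := ℝ) i
  have h0 : HasFDerivAt (fun x : EuclideanSpace ℝ (Fin 4) => (F x 0 : ℝ)) (p 0) v := by
    have : (fun x : EuclideanSpace ℝ (Fin 4) => (F x 0 : ℝ)) = fun x => p 0 x := by
      funext x; simp [hF, p]
    rw [this]
    exact (p 0).hasFDerivAt
  have e0 := (hasFDerivWithinAt_univ.1 (hcomp 0)).unique h0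
  -- component 1
  have h1 : HasFDerivAt (fun x : EuclideanSpace ℝ (Fin 4) => (F x 1 : ℝ))
      (v 1 • p 1 + v 1 • p 1 + (v 2 • p 2 + v 2 • p 2) - (v 3 • p 3 + v 3 • p 3)) v := by
    have : (fun x : EuclideanSpace ℝ (Fin 4) => (F x 1 : ℝ)) =
        fun x => p 1 x * p 1 x + p 2 x * p 2 x - p 3 x * p 3 x := by
      funext x; simp [hF, p]; ring
    rw [this]
    have hm : ∀ i : Fin 4, HasFDerivAt (fun x : EuclideanSpace ℝ (Fin 4) => p i x * p i x)
        (p i v • p i + p i v • p i) v := fun i =>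
      ((p i).hasFDerivAt.mul (p i).hasFDerivAt)
    have hv : ∀ i : Fin 4, p i v = v i := fun i => rfl
    simp only [hv] at hm
    exact ((hm 1).add (hm 2)).sub (hm 3)
  have e1 := (hasFDerivWithinAt_univ.1 (hcomp 1)).unique h1
  constructor
  · have := congrArg (fun L : EuclideanSpace ℝ (Fin 4) →L[ℝ] ℝ => L w) e0
    simpa [p] using this
  · have := congrArg (fun L : EuclideanSpace ℝ (Fin 4) →L[ℝ] ℝ => L w) e1
    simp [p] at this
    rw [this]; ring

/-- **Surjectivity of the differential of the fold normal form**: `dF_v` is onto iff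
`(v₁, v₂, v₃) ≠ 0`, i.e. the critical set of `(t, x) ↦ (t, x₁² + x₂² - x₃²)` is the `t`-axis.
[folklore] -/
theorem surjective_fderiv_foldNormalForm_iff (v : EuclideanSpace ℝ (Fin 4)) :
    Function.Surjective (fderiv ℝ (fun v : EuclideanSpace ℝ (Fin 4) =>
      (WithLp.toLp 2 ![v 0, v 1 ^ 2 + v 2 ^ 2 - v 3 ^ 2] : EuclideanSpace ℝ (Fin 2))) v) ↔
      ¬ (v 1 = 0 ∧ v 2 = 0 ∧ v 3 = 0) := by
  set D := fderiv ℝ (fun v : EuclideanSpace ℝ (Fin 4) =>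
      (WithLp.toLp 2 ![v 0, v 1 ^ 2 + v 2 ^ 2 - v 3 ^ 2] : EuclideanSpace ℝ (Fin 2))) v with hD
  have hcomp : ∀ w, (D w) 0 = w 0 ∧ (D w) 1 = 2 * (v 1 * w 1 + v 2 * w 2 - v 3 * w 3) :=
    fun w => fderiv_foldNormalForm_apply v w
  constructor
  · rintro hs ⟨h1, h2, h3⟩
    obtain ⟨w, hw⟩ := hs (EuclideanSpace.single (1 : Fin 2) (1 : ℝ))
    have := (hcomp w).2
    rw [hw, h1, h2, h3] at this
    simp at this
  · intro hv y
    have hpos : 0 < v 1 ^ 2 + v 2 ^ 2 + v 3 ^ 2 := by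
      rcases not_and_or.mp hv with h | h
      · have := sq_pos_of_ne_zero h
        positivity
      rcases not_and_or.mp h with h | h
      · have := sq_pos_of_ne_zero h
        positivity
      · have := sq_pos_of_ne_zero h
        positivity
    set c : ℝ := y 1 / (2 * (v 1 ^ 2 + v 2 ^ 2 + v 3 ^ 2)) with hc
    refine ⟨WithLp.toLp 2 ![y 0, c * v 1, c * v 2, -(c * v 3)], ?_⟩
    obtain ⟨e0, e1⟩ := hcomp (WithLp.toLp 2 ![y 0, c * v 1, c * v 2, -(c * v 3)])
    ext i
    fin_cases i
    · simpa using e0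
    · simp only [Fin.mk_one]
      rw [e1]
      simp only [Matrix.cons_val_one, Matrix.cons_val_zero, Matrix.cons_val]
      rw [hc]
      field_simp
      ring

end FoldModel

/-! ### Critical points in an indefinite fold chart -/

section FoldChart

variable {X : Type*} [TopologicalSpace X] [ChartedSpace (EuclideanSpace ℝ (Fin 4)) X]
  {f : X → Metric.sphere (0 : EuclideanSpace ℝ (Fin 3)) 1}
  {φ : OpenPartialHomeomorph X (EuclideanSpace ℝ (Fin 4))}
  {ψ : OpenPartialHomeomorph (Metric.sphere (0 : EuclideanSpace ℝ (Fin 3)) 1)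
    (EuclideanSpace ℝ (Fin 2))}

/-- **Chain rule in a fold chart.**  If in the charts `φ` of `X` and `ψ` of `S²` (`C¹` with `C¹`
inverses, `f (φ.source) ⊆ ψ.source`) the map `f` is the fold normal form
`ψ (f q) = ((φ q)₀, (φ q)₁² + (φ q)₂² - (φ q)₃²)` on `φ.source` (Hayano 2011, Def. 2.1 (4)), then
at every `q ∈ φ.source` where `f` is differentiable `dψ ∘ df_q = dF_{φ q} ∘ dφ_q`, `F` the normal
form. [folklore] -/
theorem mfderiv_comp_eq_of_fold_chart (hmaps : Set.MapsTo f φ.source ψ.source)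
    (hφ : ContMDiffOn (𝓡 4) (𝓡 4) 1 φ φ.source)
    (hψ : ContMDiffOn (𝓡 2) (𝓡 2) 1 ψ ψ.source) (hψs : ContMDiffOn (𝓡 2) (𝓡 2) 1 ψ.symm ψ.target)
    (hmodel : ∀ q ∈ φ.source, (ψ (f q)) 0 = (φ q) 0 ∧
      (ψ (f q)) 1 = (φ q) 1 ^ 2 + (φ q) 2 ^ 2 - (φ q) 3 ^ 2)
    {q : X} (hq : q ∈ φ.source) (hfq : MDifferentiableAt (𝓡 4) (𝓡 2) f q) :
    (mfderiv (𝓡 2) (𝓡 2) ψ (f q)).comp (mfderiv (𝓡 4) (𝓡 2) f q) =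
      (fderiv ℝ (fun v : EuclideanSpace ℝ (Fin 4) =>
          (WithLp.toLp 2 ![v 0, v 1 ^ 2 + v 2 ^ 2 - v 3 ^ 2] : EuclideanSpace ℝ (Fin 2)))
          (φ q)).comp (mfderiv (𝓡 4) (𝓡 4) φ q) := by
  set F : EuclideanSpace ℝ (Fin 4) → EuclideanSpace ℝ (Fin 2) := fun v =>
    WithLp.toLp 2 ![v 0, v 1 ^ 2 + v 2 ^ 2 - v 3 ^ 2] with hF
  have hψd : ψ.MDifferentiable (𝓡 2) (𝓡 2) :=
    ⟨hψ.mdifferentiableOn one_ne_zero, hψs.mdifferentiableOn one_ne_zero⟩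
  -- `ψ ∘ f = F ∘ φ` near `q`
  have heq : (fun x => ψ (f x)) =ᶠ[𝓝 q] fun x => F (φ x) := by
    filter_upwards [φ.open_source.mem_nhds hq] with x hx
    obtain ⟨h0, h1⟩ := hmodel x hx
    ext i
    fin_cases i
    · simpa [hF] using h0
    · simpa [hF] using h1
  have hFd : HasMFDerivAt (𝓡 4) (𝓡 2) F (φ q) (fderiv ℝ F (φ q)) :=
    ((contDiff_foldNormalForm.differentiable (by simp)) (φ q)).hasFDerivAt.hasMFDerivAt
  have h1 : HasMFDerivAt (𝓡 4) (𝓡 2) (fun x => ψ (f x)) q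
      ((mfderiv (𝓡 2) (𝓡 2) ψ (f q)).comp (mfderiv (𝓡 4) (𝓡 2) f q)) :=
    (hψd.mdifferentiableAt (hmaps hq)).hasMFDerivAt.comp q hfq.hasMFDerivAt
  have h2 : HasMFDerivAt (𝓡 4) (𝓡 2) (fun x => F (φ x)) q
      ((fderiv ℝ F (φ q)).comp (mfderiv (𝓡 4) (𝓡 4) φ q)) :=
    hFd.comp q ((hφ q hq).mdifferentiableWithinAt one_ne_zero |>.mdifferentiableAt
      (φ.open_source.mem_nhds hq)).hasMFDerivAt
  rw [← h1.mfderiv, ← h2.mfderiv]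
  exact heq.mfderiv_eq

/-- **In an indefinite fold chart the critical points of `f` are exactly the points of the axis
`x₁ = x₂ = x₃ = 0`.**  Let `φ` be a chart of `X` and `ψ` a chart of `S²` (homeomorphisms onto
open subsets of the model spaces, `C¹` with `C¹` inverses), `f (φ.source) ⊆ ψ.source`, and
suppose that in these charts `f` is the fold normal form
`ψ (f q) = ((φ q)₀, (φ q)₁² + (φ q)₂² - (φ q)₃²)` for `q ∈ φ.source` (Hayano 2011, Def. 2.1 (4):
*"`(y₁, y₂) = f(t, x₁, x₂, x₃) = (t, x₁² + x₂² - x₃²)`"*, with *"`Z = {(t, 0, 0, 0)}`"*).  Then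
for `q ∈ φ.source` at which `f` is differentiable, `df_q` is onto iff
`((φ q)₁, (φ q)₂, (φ q)₃) ≠ 0`: the chart differentials are invertible and the differential of
the normal form at `v` is onto iff `(v₁, v₂, v₃) ≠ 0`.  So the round locus meets the chart
domain in the image of the `t`-axis. [cite: Hayano2011, Def. 2.1 (4)] -/
theorem surjective_mfderiv_iff_of_fold_chart (hmaps : Set.MapsTo f φ.source ψ.source)
    (hφ : ContMDiffOn (𝓡 4) (𝓡 4) 1 φ φ.source) (hφs : ContMDiffOn (𝓡 4) (𝓡 4) 1 φ.symm φ.target)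
    (hψ : ContMDiffOn (𝓡 2) (𝓡 2) 1 ψ ψ.source) (hψs : ContMDiffOn (𝓡 2) (𝓡 2) 1 ψ.symm ψ.target)
    (hmodel : ∀ q ∈ φ.source, (ψ (f q)) 0 = (φ q) 0 ∧
      (ψ (f q)) 1 = (φ q) 1 ^ 2 + (φ q) 2 ^ 2 - (φ q) 3 ^ 2)
    {q : X} (hq : q ∈ φ.source) (hfq : MDifferentiableAt (𝓡 4) (𝓡 2) f q) :
    Function.Surjective (mfderiv (𝓡 4) (𝓡 2) f q) ↔
      ¬ ((φ q) 1 = 0 ∧ (φ q) 2 = 0 ∧ (φ q) 3 = 0) := by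
  have hcomp := mfderiv_comp_eq_of_fold_chart hmaps hφ hψ hψs hmodel hq hfq
  set F : EuclideanSpace ℝ (Fin 4) → EuclideanSpace ℝ (Fin 2) := fun v =>
    WithLp.toLp 2 ![v 0, v 1 ^ 2 + v 2 ^ 2 - v 3 ^ 2] with hF
  have hφd : φ.MDifferentiable (𝓡 4) (𝓡 4) :=
    ⟨hφ.mdifferentiableOn one_ne_zero, hφs.mdifferentiableOn one_ne_zero⟩
  have hψd : ψ.MDifferentiable (𝓡 2) (𝓡 2) :=
    ⟨hψ.mdifferentiableOn one_ne_zero, hψs.mdifferentiableOn one_ne_zero⟩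
  -- transfer surjectivity through the invertible chart differentials
  have hψb := hψd.mfderiv_bijective (hmaps hq)
  have hφs' := hφd.mfderiv_surjective hq
  rw [← surjective_fderiv_foldNormalForm_iff (φ q)]
  constructor
  · intro hs
    have : Function.Surjective ((fderiv ℝ F (φ q)).comp (mfderiv (𝓡 4) (𝓡 4) φ q)) := by
      rw [← hcomp]
      exact hψb.2.comp hs
    exact Function.Surjective.of_comp this
  · intro hs
    have hc : Function.Surjective
        ((mfderiv (𝓡 2) (𝓡 2) ψ (f q)).comp (mfderiv (𝓡 4) (𝓡 2) f q)) := by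
      rw [hcomp]
      exact hs.comp hφs'
    intro z
    obtain ⟨w, hw⟩ := hc (mfderiv (𝓡 2) (𝓡 2) ψ (f q) z)
    exact ⟨w, hψb.1 hw⟩

/-- **The differential of `f` does not vanish on a fold chart**: with the hypotheses of
`surjective_mfderiv_iff_of_fold_chart`, `df_q ≠ 0` for every `q ∈ φ.source` (the normal form
has `∂y₁/∂t = 1`).  In particular no Lefschetz critical point (where `df = 0`) lies in the
domain of a fold chart. [folklore] -/
theorem mfderiv_ne_zero_of_fold_chart (hmaps : Set.MapsTo f φ.source ψ.source)
    (hφ : ContMDiffOn (𝓡 4) (𝓡 4) 1 φ φ.source) (hφs : ContMDiffOn (𝓡 4) (𝓡 4) 1 φ.symm φ.target)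
    (hψ : ContMDiffOn (𝓡 2) (𝓡 2) 1 ψ ψ.source) (hψs : ContMDiffOn (𝓡 2) (𝓡 2) 1 ψ.symm ψ.target)
    (hmodel : ∀ q ∈ φ.source, (ψ (f q)) 0 = (φ q) 0 ∧
      (ψ (f q)) 1 = (φ q) 1 ^ 2 + (φ q) 2 ^ 2 - (φ q) 3 ^ 2)
    {q : X} (hq : q ∈ φ.source) (hfq : MDifferentiableAt (𝓡 4) (𝓡 2) f q) :
    mfderiv (𝓡 4) (𝓡 2) f q ≠ 0 := by
  intro h0
  have hcomp := mfderiv_comp_eq_of_fold_chart hmaps hφ hψ hψs hmodel hq hfq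
  set F : EuclideanSpace ℝ (Fin 4) → EuclideanSpace ℝ (Fin 2) := fun v =>
    WithLp.toLp 2 ![v 0, v 1 ^ 2 + v 2 ^ 2 - v 3 ^ 2] with hF
  have hφd : φ.MDifferentiable (𝓡 4) (𝓡 4) :=
    ⟨hφ.mdifferentiableOn one_ne_zero, hφs.mdifferentiableOn one_ne_zero⟩
  rw [h0, ContinuousLinearMap.comp_zero] at hcomp
  -- so `dF ∘ dφ = 0`; but `dφ` is onto and `(dF w)₀ = w₀`
  have hzero : ∀ w, fderiv ℝ F (φ q) (mfderiv (𝓡 4) (𝓡 4) φ q w) = 0 := fun w => by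
    have := DFunLike.congr_fun hcomp w
    exact this.symm
  obtain ⟨w, hw⟩ := hφd.mfderiv_surjective hq (EuclideanSpace.single (0 : Fin 4) (1 : ℝ))
  have h1 := (fderiv_foldNormalForm_apply (φ q) (EuclideanSpace.single (0 : Fin 4) (1 : ℝ))).1
  have h2 := hzero w
  rw [hw] at h2
  rw [h2] at h1
  simp at h1

end FoldChart

/-! ### Consequences for simplified broken Lefschetz fibrations -/

namespace IsSimplifiedBrokenLefschetzFibration

variable {X : Type u} [TopologicalSpace X] [ChartedSpace (EuclideanSpace ℝ (Fin 4)) X]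
  [IsManifold (𝓡 4) 1 X] {o : SmoothOrientation (𝓡 4) X}
  {f : X → Metric.sphere (0 : EuclideanSpace ℝ (Fin 3)) 1} {L : Finset X} {h : ℕ}

/-- **Local structure of the round locus of an SBLF.**  Every point `p` of the round locus (a
critical point of `f` off `L`) has a chart `φ` of `X` centred at `p`, `C^∞` with `C^∞` inverse,
in whose domain the critical points of `f` are exactly the points `q` with
`(φ q)₁ = (φ q)₂ = (φ q)₃ = 0` (the `t`-axis of Hayano 2011, Def. 2.1 (4)) and which contains no
Lefschetz critical point. [cite: Hayano2011, Def. 2.1 (4)] -/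
theorem exists_chart_round (hf : IsSimplifiedBrokenLefschetzFibration o f L h) {p : X}
    (hp : ¬ Function.Surjective (mfderiv (𝓡 4) (𝓡 2) f p)) (hpL : p ∉ L) :
    ∃ φ : OpenPartialHomeomorph X (EuclideanSpace ℝ (Fin 4)),
      p ∈ φ.source ∧ φ p = 0 ∧ ContMDiffOn (𝓡 4) (𝓡 4) ∞ φ φ.source ∧
      ContMDiffOn (𝓡 4) (𝓡 4) ∞ φ.symm φ.target ∧
      (∀ q ∈ φ.source, (¬ Function.Surjective (mfderiv (𝓡 4) (𝓡 2) f q) ↔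
        (φ q) 1 = 0 ∧ (φ q) 2 = 0 ∧ (φ q) 3 = 0)) ∧
      ∀ q ∈ φ.source, q ∉ L := by
  obtain ⟨φ, ψ, hpφ, hφ0, hmaps, hφ, hφs, hψ, hψs, hmodel⟩ := hf.fold p hp hpL
  have hfd : ∀ q, MDifferentiableAt (𝓡 4) (𝓡 2) f q := fun q =>
    (hf.contMDiff q).mdifferentiableAt (by simp)
  refine ⟨φ, hpφ, hφ0, hφ, hφs, fun q hq => ?_, fun q hq hqL => ?_⟩
  · rw [surjective_mfderiv_iff_of_fold_chart hmaps (hφ.of_le (by simp)) (hφs.of_le (by simp))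
      (hψ.of_le (by simp)) (hψs.of_le (by simp)) hmodel hq (hfd q), not_not]
  · exact mfderiv_ne_zero_of_fold_chart hmaps (hφ.of_le (by simp)) (hφs.of_le (by simp))
      (hψ.of_le (by simp)) (hψs.of_le (by simp)) hmodel hq (hfd q)
      ((hf.lefschetz q hqL).mfderiv_eq_zero)

/-- **Lefschetz critical values avoid the round image**: `f` is injective on the whole critical
set (Hayano 2011, Def. 2.1 (5)), so a Lefschetz point and a round point have different values.
[cite: Hayano2011, Def. 2.1 (5)] -/
theorem apply_ne_apply_of_mem_of_round (hf : IsSimplifiedBrokenLefschetzFibration o f L h)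
    {p z : X} (hp : p ∈ L) (hz : ¬ Function.Surjective (mfderiv (𝓡 4) (𝓡 2) f z))
    (hzL : z ∉ L) : f z ≠ f p := fun he =>
  hzL (hf.injOn_crit hz (hf.not_surjective_mfderiv_of_mem hp) he ▸ hp)

end IsSimplifiedBrokenLefschetzFibration

/-! ### The submersive locus of a smooth map between manifolds is open -/

section RegularOpen

variable {m q : ℕ} {M : Type*} [TopologicalSpace M] [ChartedSpace (EuclideanSpace ℝ (Fin m)) M]
  [IsManifold (𝓡 m) ∞ M] {N : Type*} [TopologicalSpace N]
  [ChartedSpace (EuclideanSpace ℝ (Fin q)) N] [IsManifold (𝓡 q) ∞ N] {f : M → N}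

/-- **The submersive locus of a `C^∞` map between manifolds is open.**  For `f : M → N` of
class `C^∞` between manifolds modelled on `ℝᵐ`, `ℝ^q`, the set of points where `df` is onto is
open (Hirsch, *Differential Topology* (1976), Ch. 1 §3: the rank is lower semicontinuous).
Reduced to the Euclidean-target case `Literature.Topology.Immersions.isOpen_setOf_surjective_mfderiv`
on the open submanifold `f⁻¹(dom ψ)`, `ψ` a chart of `N`, via `ψ ∘ f`: the differential of a
chart is bijective and the inclusion of an open submanifold has identity differential.
[cite: HirschDT1976, Ch. 1 §3] -/
theorem isOpen_setOf_surjective_mfderiv_of_contMDiff (hf : ContMDiff (𝓡 m) (𝓡 q) ∞ f) :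
    IsOpen {x : M | Surjective (mfderiv (𝓡 m) (𝓡 q) f x)} := by
  rw [isOpen_iff_forall_mem_open]
  intro p hp
  set ψ := chartAt (EuclideanSpace ℝ (Fin q)) (f p) with hψ
  let U : TopologicalSpace.Opens M := ⟨f ⁻¹' ψ.source, ψ.open_source.preimage hf.continuous⟩
  set F : U → EuclideanSpace ℝ (Fin q) := fun u => ψ (f u) with hF
  have hFs : ContMDiff (𝓡 m) (𝓡 q) ∞ F :=
    (contMDiffOn_chart (x := f p)).comp_contMDiff (hf.comp contMDiff_subtype_val) fun u => u.2
  have hiff : ∀ u : U, Surjective (mfderiv (𝓡 m) (𝓡 q) F u) ↔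
      Surjective (mfderiv (𝓡 m) (𝓡 q) f (u : M)) := by
    intro u
    have hval := Literature.Geometry.Manifold.OpenSubmanifold.hasMFDerivAt_subtype_val
      (I := 𝓡 m) (U := U) u
    have hfu : MDifferentiableAt (𝓡 m) (𝓡 q) f (u : M) := (hf u).mdifferentiableAt (by simp)
    have hψu : MDifferentiableAt (𝓡 q) (𝓡 q) ψ (f u) :=
      (mdifferentiable_chart (f p)).mdifferentiableAt u.2
    have hc : HasMFDerivAt (𝓡 m) (𝓡 q) F u ((mfderiv (𝓡 q) (𝓡 q) ψ (f u)).comp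
        ((mfderiv (𝓡 m) (𝓡 q) f (u : M)).comp (ContinuousLinearMap.id ℝ _))) :=
      hψu.hasMFDerivAt.comp u (hfu.hasMFDerivAt.comp u hval)
    rw [hc.mfderiv]
    have hb := (mdifferentiable_chart (f p)).mfderiv_bijective (I := 𝓡 q) (I' := 𝓡 q) u.2
    constructor
    · intro hs w
      obtain ⟨v, hv⟩ := hs (mfderiv (𝓡 q) (𝓡 q) ψ (f u) w)
      exact ⟨v, hb.1 hv⟩
    · intro hs
      exact hb.2.comp (hs.comp surjective_id)
  have hO := Literature.Topology.Immersions.isOpen_setOf_surjective_mfderiv hFs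
  refine ⟨Subtype.val '' {u : U | Surjective (mfderiv (𝓡 m) (𝓡 q) F u)}, ?_,
    U.2.isOpenMap_subtype_val _ hO, ?_⟩
  · rintro _ ⟨u, hu, rfl⟩
    exact (hiff u).1 hu
  · exact ⟨⟨p, mem_chart_source _ (f p)⟩, (hiff _).2 hp, rfl⟩

/-- **The critical set of a `C^∞` map between manifolds is closed** (complement of the
submersive locus). [cite: HirschDT1976, Ch. 1 §3] -/
theorem isClosed_setOf_not_surjective_mfderiv_of_contMDiff (hf : ContMDiff (𝓡 m) (𝓡 q) ∞ f) :
    IsClosed {x : M | ¬ Surjective (mfderiv (𝓡 m) (𝓡 q) f x)} := by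
  rw [← isOpen_compl_iff]
  convert isOpen_setOf_surjective_mfderiv_of_contMDiff hf using 1
  ext x
  simp

end RegularOpen

/-! ### Regular fibres are embedded submanifolds -/

section RegularFibre

variable {n m k : ℕ} {M : Type u} [TopologicalSpace M] [T2Space M] [SecondCountableTopology M]
  [ChartedSpace (EuclideanSpace ℝ (Fin n)) M] [IsManifold (𝓡 n) ∞ M]
  {N : Type*} [TopologicalSpace N] [ChartedSpace (EuclideanSpace ℝ (Fin k)) N]
  [IsManifold (𝓡 k) ∞ N] {f : M → N}

/-- **The regular value theorem for maps between manifolds: a regular fibre is an embedded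
submanifold** (Hirsch, *Differential Topology* (1976), Ch. 1 §3, Thm. 3.2: *"If `y ∈ f(M)` is a
regular value, then `f⁻¹(y)` is a `Cʳ` submanifold of `M`"* of dimension `dim M - dim N`).  For a
`C^∞` map `f : M → N` between manifolds without boundary modelled on `ℝⁿ`, `ℝᵏ`, `n = m + k`
(`M` Hausdorff, second countable), and a regular value `y` (`df_q` onto for every `q` with
`f q = y`), there are a `C^∞` `m`-manifold `F` without boundary (Hausdorff, second countable) and
a `C^∞` embedding `e : F → M` with `range e = f⁻¹(y)`.  Reduced to the tree's Euclidean-target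
`exists_regularPreimage` applied to `ψ ∘ f` on the open submanifold of regular points of
`f⁻¹(dom ψ)`, `ψ` the chart of `N` at `y`. [cite: HirschDT1976, Ch. 1 §3 Thm. 3.2] -/
theorem exists_isSmoothEmbedding_range_eq_preimage (hn : n = m + k)
    (hf : ContMDiff (𝓡 n) (𝓡 k) ∞ f) {y : N}
    (hy : ∀ q, f q = y → Surjective (mfderiv (𝓡 n) (𝓡 k) f q)) :
    ∃ (F : Type u) (_ : TopologicalSpace F) (_ : T2Space F) (_ : SecondCountableTopology F)
      (_ : ChartedSpace (EuclideanSpace ℝ (Fin m)) F) (_ : IsManifold (𝓡 m) ∞ F) (e : F → M),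
      Manifold.IsSmoothEmbedding (𝓡 m) (𝓡 n) ∞ e ∧ range e = f ⁻¹' {y} := by
  have h1 : (1 : ℕ∞ω) ≤ ∞ := by exact_mod_cast le_top
  have h0 : (∞ : ℕ∞ω) ≠ 0 := by simp
  set ψ := chartAt (EuclideanSpace ℝ (Fin k)) y with hψ
  let U : TopologicalSpace.Opens M :=
    ⟨{x : M | Surjective (mfderiv (𝓡 n) (𝓡 k) f x)} ∩ f ⁻¹' ψ.source,
      (isOpen_setOf_surjective_mfderiv_of_contMDiff hf).inter
        (ψ.open_source.preimage hf.continuous)⟩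
  set G : U → EuclideanSpace ℝ (Fin k) := fun u => ψ (f u) with hG
  have hGs : ContMDiff (𝓡 n) (𝓡 k) ∞ G :=
    (contMDiffOn_chart (x := y)).comp_contMDiff (hf.comp contMDiff_subtype_val) fun u => u.2.2
  have hval := fun u : U =>
    Literature.Geometry.Manifold.OpenSubmanifold.hasMFDerivAt_subtype_val (I := 𝓡 n) (U := U) u
  have hGsurj : ∀ u : U, Surjective (mfderiv (𝓡 n) (𝓡 k) G u) := by
    intro u
    have hfu : MDifferentiableAt (𝓡 n) (𝓡 k) f (u : M) := (hf u).mdifferentiableAt h0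
    have hψu : MDifferentiableAt (𝓡 k) (𝓡 k) ψ (f u) :=
      (mdifferentiable_chart y).mdifferentiableAt u.2.2
    have hc : HasMFDerivAt (𝓡 n) (𝓡 k) G u ((mfderiv (𝓡 k) (𝓡 k) ψ (f u)).comp
        ((mfderiv (𝓡 n) (𝓡 k) f (u : M)).comp (ContinuousLinearMap.id ℝ _))) :=
      hψu.hasMFDerivAt.comp u (hfu.hasMFDerivAt.comp u (hval u))
    rw [hc.mfderiv]
    have hb := (mdifferentiable_chart y).mfderiv_bijective (I := 𝓡 k) (I' := 𝓡 k) u.2.2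
    exact hb.2.comp (u.2.1.comp surjective_id)
  obtain ⟨F, _, _, _, _, _, e, he, hre, -⟩ :=
    exists_regularPreimage k m n hn U G hGs hGsurj (ψ y)
  have hediff : ∀ z, MDifferentiableAt (𝓡 m) (𝓡 n) e z := fun z =>
    he.contMDiff.mdifferentiableAt h0
  have hmf_comp : ∀ z w, mfderiv (𝓡 m) (𝓡 n) ((Subtype.val : U → M) ∘ e) z w =
      mfderiv (𝓡 m) (𝓡 n) e z w := by
    intro z w
    rw [mfderiv_comp z (hval (e z)).mdifferentiableAt (hediff z), (hval (e z)).mfderiv]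
    rfl
  refine ⟨F, inferInstance, inferInstance, inferInstance, inferInstance, inferInstance,
    Subtype.val ∘ e, ?_, ?_⟩
  · have hcont : ContMDiff (𝓡 m) (𝓡 n) ∞ ((Subtype.val : U → M) ∘ e) :=
      contMDiff_subtype_val.comp he.contMDiff
    refine ⟨isImmersion_of_injective_mfderiv hcont h1 fun z a b hab => ?_,
      Topology.IsEmbedding.subtypeVal.comp he.isEmbedding⟩
    rw [hmf_comp, hmf_comp] at hab
    exact injective_mfderiv_of_isImmersionAt' (he.isImmersion.isImmersionAt z) hab
  · rw [range_comp, hre]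
    ext x
    simp only [mem_image, mem_preimage, mem_singleton_iff]
    constructor
    · rintro ⟨u, hu, rfl⟩
      exact ψ.injOn u.2.2 (mem_chart_source _ y) hu
    · intro hx
      exact ⟨⟨x, hy x hx, by simp [hx, hψ]⟩, by simp [hG, hx], rfl⟩

end RegularFibre

/-! ### Regular fibres of maps to surfaces as oriented level surfaces -/

section OrientedFibre

variable {X : Type u} [TopologicalSpace X] [T2Space X] [SecondCountableTopology X]
  [ChartedSpace (EuclideanSpace ℝ (Fin 4)) X] [IsManifold (𝓡 4) ∞ X]
  {N : Type*} [TopologicalSpace N] [ChartedSpace (EuclideanSpace ℝ (Fin 2)) N]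
  [IsManifold (𝓡 2) ∞ N] {f : X → N}

/-- **A regular fibre of a smooth map from an orientable 4-manifold to a surface is an embedded
orientable surface.**  For a `C^∞` map `f : X → N` (`X` a Hausdorff second-countable
4-manifold without boundary, `N` a surface) and a regular value `y`, there are an `C^∞`
2-manifold `F` without boundary (Hausdorff, second countable) and a topological embedding
`e : F → X`, `C^∞` as a map to `X`, with `range e = f⁻¹(y)`; if `X` is orientable so is `F`.
Construction (Milnor 1963, Thm. 3.1; Hirsch 1976, Ch. 1 §3 Thm. 3.2 and §4.4): in the chart `ψ`
of `N` at `y` the fibre is `{ψ₀ ∘ f = c₀} ∩ {ψ₁ ∘ f = c₁}` inside the open set `U` of regular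
points over `dom ψ`; `c₀` is a regular level of `ψ₀ ∘ f` on `U`, whose level is presented as
the boundary `Y = ∂{ψ₀ ∘ f ≤ c₀}` of the tree's regular domain (`RegularSublevel`, with the
boundary-manifold structure), a 3-manifold, orientable as the boundary of an orientable domain
(`RegularSublevel.isOrientable`, `isOrientable_boundary`); on `Y`, `c₁` is a regular level of
`ψ₁ ∘ f` (the tangent space of `Y` is `ker d(ψ₀ ∘ f)`, on which `d(ψ₁ ∘ f)` does not vanish
since `d(ψ ∘ f)` is onto), and the fibre is `F = ∂{ψ₁ ∘ f ≤ c₁} ⊆ Y`, again orientable.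
This version also records that the differential of `e` is everywhere injective (the inclusions
of regular domains and of boundaries are immersions), so that `e` is a smooth embedding whenever
`F` is compact (`isSmoothEmbedding_of_injective_of_injective_mfderiv`); the statement without
this clause is `exists_orientable_surface_range_eq_preimage`.
[cite: HirschDT1976, Ch. 1 §3 Thm. 3.2 and §4.4] -/
theorem exists_orientable_surface_range_eq_preimage_injective_mfderiv
    (hf : ContMDiff (𝓡 4) (𝓡 2) ∞ f) {y : N}
    (hy : ∀ q, f q = y → Surjective (mfderiv (𝓡 4) (𝓡 2) f q)) :
    ∃ (F : Type u) (_ : TopologicalSpace F) (_ : T2Space F) (_ : SecondCountableTopology F)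
      (_ : ChartedSpace (EuclideanSpace ℝ (Fin 2)) F) (_ : IsManifold (𝓡 2) ∞ F) (e : F → X),
      ContMDiff (𝓡 2) (𝓡 4) ∞ e ∧ Topology.IsEmbedding e ∧ range e = f ⁻¹' {y} ∧
        (IsOrientable (𝓡 4) X → IsOrientable (𝓡 2) F) ∧
        ∀ z, Injective (mfderiv (𝓡 2) (𝓡 4) e z) := by
  have h0 : (∞ : ℕ∞ω) ≠ 0 := by simp
  set ψ := chartAt (EuclideanSpace ℝ (Fin 2)) y with hψ
  -- the open set of regular points over the chart domain
  let U : TopologicalSpace.Opens X :=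
    ⟨{x : X | Surjective (mfderiv (𝓡 4) (𝓡 2) f x)} ∩ f ⁻¹' ψ.source,
      (isOpen_setOf_surjective_mfderiv_of_contMDiff hf).inter
        (ψ.open_source.preimage hf.continuous)⟩
  set G : U → EuclideanSpace ℝ (Fin 2) := fun u => ψ (f u) with hG
  have hGs : ContMDiff (𝓡 4) (𝓡 2) ∞ G :=
    (contMDiffOn_chart (x := y)).comp_contMDiff (hf.comp contMDiff_subtype_val) fun u => u.2.2
  have hGd : ∀ u, MDifferentiableAt (𝓡 4) (𝓡 2) G u := fun u => (hGs u).mdifferentiableAt h0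
  have hval := fun u : U =>
    Literature.Geometry.Manifold.OpenSubmanifold.hasMFDerivAt_subtype_val (I := 𝓡 4) (U := U) u
  have hGsurj : ∀ u : U, Surjective (mfderiv (𝓡 4) (𝓡 2) G u) := by
    intro u
    have hfu : MDifferentiableAt (𝓡 4) (𝓡 2) f (u : X) := (hf u).mdifferentiableAt h0
    have hψu : MDifferentiableAt (𝓡 2) (𝓡 2) ψ (f u) :=
      (mdifferentiable_chart y).mdifferentiableAt u.2.2
    have hc : HasMFDerivAt (𝓡 4) (𝓡 2) G u ((mfderiv (𝓡 2) (𝓡 2) ψ (f u)).comp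
        ((mfderiv (𝓡 4) (𝓡 2) f (u : X)).comp (ContinuousLinearMap.id ℝ _))) :=
      hψu.hasMFDerivAt.comp u (hfu.hasMFDerivAt.comp u (hval u))
    rw [hc.mfderiv]
    have hb := (mdifferentiable_chart y).mfderiv_bijective (I := 𝓡 2) (I' := 𝓡 2) u.2.2
    exact hb.2.comp (u.2.1.comp surjective_id)
  -- the two coordinates of `G`
  set pr : Fin 2 → (EuclideanSpace ℝ (Fin 2) →L[ℝ] ℝ) := fun i => EuclideanSpace.proj i with hpr
  set g₀ : U → ℝ := fun u => pr 0 (G u) with hg₀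
  set g₁ : U → ℝ := fun u => pr 1 (G u) with hg₁
  have hg₀s : ContMDiff (𝓡 4) 𝓘(ℝ, ℝ) ∞ g₀ := (pr 0).contDiff.comp_contMDiff hGs
  have hg₁s : ContMDiff (𝓡 4) 𝓘(ℝ, ℝ) ∞ g₁ := (pr 1).contDiff.comp_contMDiff hGs
  have hmf₀ : ∀ u ξ, mfderiv (𝓡 4) 𝓘(ℝ, ℝ) g₀ u ξ = pr 0 (mfderiv (𝓡 4) (𝓡 2) G u ξ) := by
    intro u ξ
    rw [hg₀, show (fun u => pr 0 (G u)) = pr 0 ∘ G from rfl,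
      mfderiv_comp u (pr 0).mdifferentiableAt (hGd u), ContinuousLinearMap.mfderiv_eq]
    rfl
  have hmf₁ : ∀ u ξ, mfderiv (𝓡 4) 𝓘(ℝ, ℝ) g₁ u ξ = pr 1 (mfderiv (𝓡 4) (𝓡 2) G u ξ) := by
    intro u ξ
    rw [hg₁, show (fun u => pr 1 (G u)) = pr 1 ∘ G from rfl,
      mfderiv_comp u (pr 1).mdifferentiableAt (hGd u), ContinuousLinearMap.mfderiv_eq]
    rfl
  set c : EuclideanSpace ℝ (Fin 2) := ψ y with hc
  -- `c 0` is a regular level of `g₀`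
  have hreg₀ : IsRegularLevel (𝓡 4) g₀ (c 0) := by
    refine ⟨hg₀s, fun u _ => BoundarylessManifold.isInteriorPoint, fun u _ hcrit => ?_⟩
    obtain ⟨ξ, hξ⟩ := hGsurj u (EuclideanSpace.single 0 1)
    have h1 : pr 0 (mfderiv (𝓡 4) (𝓡 2) G u ξ) = 1 := by
      rw [hξ]
      simp [hpr]
    have h2 : pr 0 (mfderiv (𝓡 4) (𝓡 2) G u ξ) = 0 := by
      rw [← hmf₀, show mfderiv (𝓡 4) 𝓘(ℝ, ℝ) g₀ u = 0 from hcrit]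
      rfl
    exact one_ne_zero (h1.symm.trans h2)
  -- the level `Y = {g₀ = c 0}` as the boundary of the regular domain `{g₀ ≤ c 0}`
  let D₁ := RegularSublevel (k := 3) hreg₀
  let Y := ↥((𝓡∂ 4).boundary D₁)
  let pt₁ : Y → U := fun z => RegularSublevel.incl hreg₀ z.1
  have hpt₁s : ContMDiff (𝓡 3) (𝓡 4) ∞ pt₁ :=
    (RegularSublevel.contMDiff_incl hreg₀).comp
      (BoundaryManifold.isSmoothEmbedding_subtype_val (n := 3) (W := D₁)).contMDiff
  have hpt₁d : ∀ z, MDifferentiableAt (𝓡 3) (𝓡 4) pt₁ z := fun z =>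
    (hpt₁s z).mdifferentiableAt h0
  have hpt₁inj : ∀ z, Injective (mfderiv (𝓡 3) (𝓡 4) pt₁ z) := by
    intro z
    have hA : MDifferentiableAt (𝓡∂ 4) (𝓡 4) (RegularSublevel.incl hreg₀) z.1 :=
      (RegularSublevel.contMDiff_incl hreg₀ z.1).mdifferentiableAt h0
    have hB : MDifferentiableAt (𝓡 3) (𝓡∂ 4) (Subtype.val : Y → D₁) z :=
      ((BoundaryManifold.isSmoothEmbedding_subtype_val (n := 3) (W := D₁)).contMDiff
        z).mdifferentiableAt h0
    rw [show pt₁ = RegularSublevel.incl hreg₀ ∘ (Subtype.val : Y → D₁) from rfl,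
      mfderiv_comp z hA hB]
    exact (injective_mfderiv_of_isImmersionAt'
        ((RegularSublevel.isSmoothEmbedding_incl hreg₀).isImmersion.isImmersionAt z.1)).comp
      (injective_mfderiv_of_isImmersionAt'
        ((BoundaryManifold.isImmersion_subtype_val (n := 3) (W := D₁)).isImmersionAt z))
  have hg₀pt₁ : ∀ z : Y, g₀ (pt₁ z) = c 0 := fun z =>
    (RegularSublevel.mem_boundary_iff hreg₀ z.1).1 z.2
  -- `c 1` is a regular level of `g₁` restricted to `Y`
  set G₁ : Y → ℝ := fun z => g₁ (pt₁ z) with hG₁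
  have hG₁s : ContMDiff (𝓡 3) 𝓘(ℝ, ℝ) ∞ G₁ := hg₁s.comp hpt₁s
  have hreg₁ : IsRegularLevel (𝓡 3) G₁ (c 1) := by
    refine ⟨hG₁s, fun z _ => BoundarylessManifold.isInteriorPoint, fun z _ hcrit => ?_⟩
    -- `T_z Y = ker dg₀`
    have hℓ : mfderiv (𝓡 4) 𝓘(ℝ, ℝ) g₀ (pt₁ z) ≠ 0 :=
      hreg₀.not_isMCriticalPt (hg₀pt₁ z)
    have hcomp0 : ∀ w, mfderiv (𝓡 4) 𝓘(ℝ, ℝ) g₀ (pt₁ z) (mfderiv (𝓡 3) (𝓡 4) pt₁ z w) = 0 := by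
      intro w
      have hcst : g₀ ∘ pt₁ = fun _ => c 0 := funext fun z => hg₀pt₁ z
      have hc' := mfderiv_comp z (hg₀s.mdifferentiableAt h0) (hpt₁d z)
      rw [hcst, mfderiv_const] at hc'
      exact (DFunLike.congr_fun hc' w).symm
    obtain ⟨ξ, hξ⟩ := hGsurj (pt₁ z) (EuclideanSpace.single 1 1)
    have hξ0 : pr 0 (mfderiv (𝓡 4) (𝓡 2) G (pt₁ z) ξ) = 0 := by
      rw [hξ]
      simp [hpr]
    have hξ1 : pr 1 (mfderiv (𝓡 4) (𝓡 2) G (pt₁ z) ξ) = 1 := by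
      rw [hξ]
      simp [hpr]
    have hξ0' : mfderiv (𝓡 4) 𝓘(ℝ, ℝ) g₀ (pt₁ z) ξ = 0 := by
      rw [hmf₀]
      exact hξ0
    obtain ⟨w, hw⟩ := exists_apply_eq_of_linearForm_apply_eq_zero (hpt₁inj z) hℓ hcomp0 hξ0'
    have key : mfderiv (𝓡 3) 𝓘(ℝ, ℝ) G₁ z w = mfderiv (𝓡 4) 𝓘(ℝ, ℝ) g₁ (pt₁ z) ξ := by
      rw [hG₁, show (fun z => g₁ (pt₁ z)) = g₁ ∘ pt₁ from rfl,
        mfderiv_comp z (hg₁s.mdifferentiableAt h0) (hpt₁d z)]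
      change mfderiv (𝓡 4) 𝓘(ℝ, ℝ) g₁ (pt₁ z) (mfderiv (𝓡 3) (𝓡 4) pt₁ z w) = _
      exact congrArg (mfderiv (𝓡 4) 𝓘(ℝ, ℝ) g₁ (pt₁ z)) hw
    have h2 : pr 1 (mfderiv (𝓡 4) (𝓡 2) G (pt₁ z) ξ) = 0 := by
      rw [← hmf₁, ← key, show mfderiv (𝓡 3) 𝓘(ℝ, ℝ) G₁ z = 0 from hcrit]
      rfl
    exact one_ne_zero (hξ1.symm.trans h2)
  -- the fibre `F = {G₁ = c 1} ⊆ Y` as the boundary of the regular domain `{G₁ ≤ c 1}`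
  let D₂ := RegularSublevel (k := 2) hreg₁
  let F := ↥((𝓡∂ 3).boundary D₂)
  let pt₂ : F → Y := fun w => RegularSublevel.incl hreg₁ w.1
  have hpt₂s : ContMDiff (𝓡 2) (𝓡 3) ∞ pt₂ :=
    (RegularSublevel.contMDiff_incl hreg₁).comp
      (BoundaryManifold.isSmoothEmbedding_subtype_val (n := 2) (W := D₂)).contMDiff
  have hG₁pt₂ : ∀ w : F, G₁ (pt₂ w) = c 1 := fun w =>
    (RegularSublevel.mem_boundary_iff hreg₁ w.1).1 w.2
  let e : F → X := fun w => ((pt₁ (pt₂ w) : U) : X)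
  have hes : ContMDiff (𝓡 2) (𝓡 4) ∞ e := contMDiff_subtype_val.comp (hpt₁s.comp hpt₂s)
  have heemb : Topology.IsEmbedding e :=
    Topology.IsEmbedding.subtypeVal.comp
      (((RegularSublevel.isEmbedding_incl hreg₀).comp Topology.IsEmbedding.subtypeVal).comp
        ((RegularSublevel.isEmbedding_incl hreg₁).comp Topology.IsEmbedding.subtypeVal))
  -- the differential of `e` is injective: `e = val ∘ pt₁ ∘ pt₂`, all three immersions
  have hpt₂d : ∀ w, MDifferentiableAt (𝓡 2) (𝓡 3) pt₂ w := fun w =>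
    (hpt₂s w).mdifferentiableAt h0
  have hpt₂inj : ∀ w, Injective (mfderiv (𝓡 2) (𝓡 3) pt₂ w) := by
    intro w
    have hA : MDifferentiableAt (𝓡∂ 3) (𝓡 3) (RegularSublevel.incl hreg₁) w.1 :=
      (RegularSublevel.contMDiff_incl hreg₁ w.1).mdifferentiableAt h0
    have hB : MDifferentiableAt (𝓡 2) (𝓡∂ 3) (Subtype.val : F → D₂) w :=
      ((BoundaryManifold.isSmoothEmbedding_subtype_val (n := 2) (W := D₂)).contMDiff
        w).mdifferentiableAt h0
    rw [show pt₂ = RegularSublevel.incl hreg₁ ∘ (Subtype.val : F → D₂) from rfl,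
      mfderiv_comp w hA hB]
    exact (injective_mfderiv_of_isImmersionAt'
        ((RegularSublevel.isSmoothEmbedding_incl hreg₁).isImmersion.isImmersionAt w.1)).comp
      (injective_mfderiv_of_isImmersionAt'
        ((BoundaryManifold.isImmersion_subtype_val (n := 2) (W := D₂)).isImmersionAt w))
  have hde : ∀ w, Injective (mfderiv (𝓡 2) (𝓡 4) e w) := by
    intro w
    have he₀inj : Injective (mfderiv (𝓡 2) (𝓡 4) (pt₁ ∘ pt₂) w) := by
      rw [mfderiv_comp w (hpt₁d (pt₂ w)) (hpt₂d w)]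
      exact (hpt₁inj (pt₂ w)).comp (hpt₂inj w)
    have he₀d : MDifferentiableAt (𝓡 2) (𝓡 4) (pt₁ ∘ pt₂) w := (hpt₁d (pt₂ w)).comp w (hpt₂d w)
    have hcomp : HasMFDerivAt (𝓡 2) (𝓡 4) ((Subtype.val : U → X) ∘ (pt₁ ∘ pt₂)) w
        ((ContinuousLinearMap.id ℝ _).comp (mfderiv (𝓡 2) (𝓡 4) (pt₁ ∘ pt₂) w)) :=
      (hval (pt₁ (pt₂ w))).comp w he₀d.hasMFDerivAt
    rw [show e = (Subtype.val : U → X) ∘ (pt₁ ∘ pt₂) from rfl, hcomp.mfderiv]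
    exact injective_id.comp he₀inj
  have hrange : range e = f ⁻¹' {y} := by
    ext x
    simp only [mem_range, mem_preimage, mem_singleton_iff]
    constructor
    · rintro ⟨w, rfl⟩
      have h₀ : g₀ (pt₁ (pt₂ w)) = c 0 := hg₀pt₁ (pt₂ w)
      have h₁ : g₁ (pt₁ (pt₂ w)) = c 1 := hG₁pt₂ w
      have hGc : G (pt₁ (pt₂ w)) = c := by
        ext i
        fin_cases i
        · simpa [hg₀, hpr] using h₀
        · simpa [hg₁, hpr] using h₁
      exact ψ.injOn (pt₁ (pt₂ w)).2.2 (mem_chart_source _ y) hGc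
    · intro hx
      have hxU : x ∈ U := ⟨hy x hx, by simp [hx, hψ]⟩
      have hGx : G ⟨x, hxU⟩ = c := by simp [hG, hx, hc]
      have hx₀ : g₀ ⟨x, hxU⟩ = c 0 := by simp [hg₀, hpr, hGx]
      let d₁ : D₁ := RegularSublevel.mk hreg₀ ⟨x, hxU⟩ hx₀.le
      have hd₁ : d₁ ∈ (𝓡∂ 4).boundary D₁ := (RegularSublevel.mem_boundary_iff hreg₀ d₁).2 hx₀
      have hx₁ : G₁ ⟨d₁, hd₁⟩ = c 1 := by simp [hG₁, hg₁, hpr, pt₁, d₁, hGx]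
      let d₂ : D₂ := RegularSublevel.mk hreg₁ ⟨d₁, hd₁⟩ hx₁.le
      have hd₂ : d₂ ∈ (𝓡∂ 3).boundary D₂ := (RegularSublevel.mem_boundary_iff hreg₁ d₂).2 hx₁
      exact ⟨⟨d₂, hd₂⟩, rfl⟩
  refine ⟨F, inferInstance, inferInstance, inferInstance, inferInstance, inferInstance, e, hes,
    heemb, hrange, fun hX => ?_, hde⟩
  have hU : IsOrientable (𝓡 4) U := hX.opens U
  have hD₁ : IsOrientable (𝓡∂ 4) D₁ := RegularSublevel.isOrientable hreg₀ hU
  have hY : IsOrientable (𝓡 3) Y := isOrientable_boundary 3 D₁ hD₁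
  have hD₂ : IsOrientable (𝓡∂ 3) D₂ := RegularSublevel.isOrientable hreg₁ hY
  exact isOrientable_boundary 2 D₂ hD₂

/-- **A regular fibre of a smooth map from an orientable 4-manifold to a surface is an embedded
orientable surface.**  For a `C^∞` map `f : X → N` (`X` a Hausdorff second-countable
4-manifold without boundary, `N` a surface) and a regular value `y`, there are an `C^∞`
2-manifold `F` without boundary (Hausdorff, second countable) and a topological embedding
`e : F → X`, `C^∞` as a map to `X`, with `range e = f⁻¹(y)`; if `X` is orientable so is `F`
(`exists_orientable_surface_range_eq_preimage_injective_mfderiv` without the clause on the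
differential). [cite: HirschDT1976, Ch. 1 §3 Thm. 3.2 and §4.4] -/
theorem exists_orientable_surface_range_eq_preimage (hf : ContMDiff (𝓡 4) (𝓡 2) ∞ f) {y : N}
    (hy : ∀ q, f q = y → Surjective (mfderiv (𝓡 4) (𝓡 2) f q)) :
    ∃ (F : Type u) (_ : TopologicalSpace F) (_ : T2Space F) (_ : SecondCountableTopology F)
      (_ : ChartedSpace (EuclideanSpace ℝ (Fin 2)) F) (_ : IsManifold (𝓡 2) ∞ F) (e : F → X),
      ContMDiff (𝓡 2) (𝓡 4) ∞ e ∧ Topology.IsEmbedding e ∧ range e = f ⁻¹' {y} ∧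
        (IsOrientable (𝓡 4) X → IsOrientable (𝓡 2) F) := by
  obtain ⟨F, _, _, _, _, _, e, hes, heemb, hrange, hor, -⟩ :=
    exists_orientable_surface_range_eq_preimage_injective_mfderiv hf hy
  exact ⟨F, inferInstance, inferInstance, inferInstance, inferInstance, inferInstance, e, hes,
    heemb, hrange, hor⟩

end OrientedFibre

/-! ### The Euler characteristic of a closed orientable surface -/

section SurfaceEuler

open CategoryTheory Limits
open Literature.AlgebraicTopology.SingularHomology

/-- **`χ(F) = 2 - b₁(F)` for a closed connected smoothly orientable surface**, with finiteness:
`H_•(F; ℤ)` is finitely generated and vanishes from degree `3` on, and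
`χ(F) = rank H₀ - rank H₁ + rank H₂ = 1 - rank H₁(F; ℤ) + 1` (Hatcher 2002, Thm. 3.26 (a),(c) and
App. A Cor. A.8–A.9: the tree's PROVED `finite_singularHomology_of_compactSpace_holds`,
`isZero_singularHomology_of_lt_holds`, `nonempty_singularHomology_top_iso_holds`, fed the
homological `ℤ`-orientation of a smooth orientation, `isOrientableOver_int_of_isOrientable_holds`).
The same computation as the tree's `finRelHomology_and_relEuler_surface`
(`Barriers/SmoothPoincare4/SmallExoticaFrontierReductionLemma8Proofs.lean`), restated from a
SMOOTH orientation so that the SBLF files need not import the barrier.  For a genus-`g` fibre,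
`rank H₁ = 2g` and `χ = 2 - 2g`. [cite: HatcherAT2002, Thm. 3.26 (a) and App. A Cor. A.8–A.9] -/
theorem finRelHomology_and_relEuler_of_isOrientable_surface (F : Type u) [TopologicalSpace F]
    [T2Space F] [CompactSpace F] [ConnectedSpace F] [ChartedSpace (EuclideanSpace ℝ (Fin 2)) F]
    [IsManifold (𝓡 2) 1 F] (hF : IsOrientable (𝓡 2) F) :
    FinRelHomology ℤ ℤ F ∅ 3 ∧
      relEuler ℤ ℤ F ∅ = 2 - (Module.finrank ℤ (singularHomology ℤ ℤ F 1) : ℤ) := by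
  obtain ⟨μ⟩ := isOrientableOver_int_of_isOrientable_holds F hF
  have h : FinRelHomology ℤ ℤ F ∅ 3 :=
    FinRelHomology.empty_of_absolute
      (fun j => finite_singularHomology_of_compactSpace_holds ℤ F 2 j)
      (fun _ hj => isZero_singularHomology_of_lt_holds ℤ ℤ F 2 (by omega))
  refine ⟨h, ?_⟩
  -- `rank H₀ = 1`: a connected manifold is path connected
  haveI := ChartedSpace.locallyPathConnectedSpace (EuclideanSpace ℝ (Fin 2)) F
  haveI : PathConnectedSpace F := pathConnectedSpace_iff_connectedSpace.mpr inferInstance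
  have h0 : Module.finrank ℤ (singularHomology ℤ ℤ F 0) = 1 := by
    rw [finrank_singularHomology_zero_of_pathConnectedSpace ℤ ℤ, Module.finrank_self]
  -- `rank H₂ = 1`: the fundamental class
  have h2 : Module.finrank ℤ (singularHomology ℤ ℤ F 2) = 1 := by
    obtain ⟨e⟩ := nonempty_singularHomology_top_iso_holds (R := ℤ) (X := F) 2 μ
    rw [e.toLinearEquiv.finrank_eq]
    change Module.finrank ℤ (ULift ℤ) = 1
    rw [ULift.moduleEquiv.finrank_eq, Module.finrank_self]
  rw [h.relEuler_empty_eq_sum]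
  simp only [Finset.sum_range_succ, Finset.sum_range_zero, h0, h2]
  push_cast
  ring

/-- **Rank bookkeeping for the genus clauses**: if `H₁(S; ℤ) ≅ ℤ^{m}` (as in the fibre clauses of
`IsSimplifiedBrokenLefschetzFibration`, `m = 2g`) and `F ≃ₜ S`, then `rank H₁(F; ℤ) = m`
(homeomorphism invariance of singular homology). [folklore] -/
theorem finrank_singularHomology_one_eq_of_homeomorph {F S : Type u} [TopologicalSpace F]
    [TopologicalSpace S] (φ : F ≃ₜ S) {m : ℕ}
    (hS : Nonempty ((Fin m → ℤ) ≃ₗ[ℤ] singularHomology ℤ ℤ S 1)) :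
    Module.finrank ℤ (singularHomology ℤ ℤ F 1) = m := by
  obtain ⟨l⟩ := hS
  rw [(singularHomology.mapIso ℤ ℤ φ 1).toLinearEquiv.finrank_eq, ← l.finrank_eq,
    Module.finrank_fin_fun]

/-- **Euler characteristic by the genus clause**: if `χ(F) = 2 - rank H₁(S; ℤ)` for a space `S`
homeomorphic to `F` (as delivered by `IsSimplifiedBrokenLefschetzFibration.exists_oriented_surface_fibre`
for a regular fibre `S = f⁻¹(y)`) and `H₁(S; ℤ) ≅ ℤ^{2g}` (the genus clause), then `χ(F) = 2 - 2g`.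
[cite: Baykur2012, Lemma 7] -/
theorem relEuler_eq_of_genus_clause {F S : Type u} [TopologicalSpace F] [TopologicalSpace S]
    (hχ : relEuler ℤ ℤ F ∅ = 2 - (Module.finrank ℤ (singularHomology ℤ ℤ S 1) : ℤ))
    (φ : F ≃ₜ S) {g : ℕ} (hg : Nonempty ((Fin (2 * g) → ℤ) ≃ₗ[ℤ] singularHomology ℤ ℤ S 1)) :
    relEuler ℤ ℤ F ∅ = 2 - 2 * g := by
  rw [hχ, ← (singularHomology.mapIso ℤ ℤ φ 1).toLinearEquiv.finrank_eq,
    finrank_singularHomology_one_eq_of_homeomorph φ hg]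
  push_cast
  ring

end SurfaceEuler

/-! ### Ehresmann over the regular values: an SBLF is a surface bundle off its critical image -/

section Ehresmann

open Literature.AlgebraicTopology.Homotopy

/-- **Changing the model fibre of a fibre bundle along a homeomorphism.** [folklore] -/
theorem isFibreBundleWith_of_fibre_homeomorph
    {E B F F' : Type*} [TopologicalSpace E] [TopologicalSpace B] [TopologicalSpace F]
    [TopologicalSpace F'] {p : E → B} (h : IsFibreBundleWith F p) (e : F ≃ₜ F') :
    IsFibreBundleWith F' p := by
  refine ⟨h.1, fun b => ?_⟩
  obtain ⟨U, hU, hb, φ, hφ⟩ := h.2 b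
  exact ⟨U, hU, hb, φ.trans ((Homeomorph.refl _).prodCongr e), fun z => hφ z⟩

variable {X : Type u} [TopologicalSpace X] [T2Space X] [SecondCountableTopology X]
  [CompactSpace X] [ChartedSpace (EuclideanSpace ℝ (Fin 4)) X] [IsManifold (𝓡 4) ∞ X]
  {f : X → Metric.sphere (0 : EuclideanSpace ℝ (Fin 3)) 1}

/-- **Ehresmann's theorem off the critical image**: a `C^∞` map `f : X → S²` from a closed
4-manifold, restricted over an open set `W` of regular values, `f⁻¹(W) → W`, is a locally
trivial fibration (Bröcker–Jänich (8.12), the tree's PROVED `ehresmann_fibration_holds`, applied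
to the proper submersion between the open submanifolds `f⁻¹(W)` and `W`; properness because `X`
is compact). [cite: BrockerJanichIDT1982, (8.12)] -/
theorem isLocallyTrivialFibration_restrictPreimage (hf : ContMDiff (𝓡 4) (𝓡 2) ∞ f)
    {W : Set (Metric.sphere (0 : EuclideanSpace ℝ (Fin 3)) 1)} (hWo : IsOpen W)
    (hW : ∀ y ∈ W, ∀ q, f q = y → Surjective (mfderiv (𝓡 4) (𝓡 2) f q)) :
    IsLocallyTrivialFibration (W.restrictPreimage f) := by
  have h0 : (∞ : ℕ∞ω) ≠ 0 := by simp
  let V : TopologicalSpace.Opens (Metric.sphere (0 : EuclideanSpace ℝ (Fin 3)) 1) := ⟨W, hWo⟩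
  let U : TopologicalSpace.Opens X := ⟨f ⁻¹' W, hWo.preimage hf.continuous⟩
  let g : U → V := fun u => ⟨f u, u.2⟩
  have hg : ContMDiff (𝓡 4) (𝓡 2) ∞ g := by
    rw [← ContMDiff.subtypeVal_comp_iff]
    exact hf.comp contMDiff_subtype_val
  have hprop : IsProperMap g := hf.continuous.isProperMap.restrictPreimage W
  have hsurj : ∀ u : U, Surjective (mfderiv (𝓡 4) (𝓡 2) g u) := by
    intro u
    have hvalU := Literature.Geometry.Manifold.OpenSubmanifold.hasMFDerivAt_subtype_val
      (I := 𝓡 4) (U := U) u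
    have hvalV := Literature.Geometry.Manifold.OpenSubmanifold.hasMFDerivAt_subtype_val
      (I := 𝓡 2) (U := V) (g u)
    have hgu : HasMFDerivAt (𝓡 4) (𝓡 2) g u (mfderiv (𝓡 4) (𝓡 2) g u) :=
      ((hg u).mdifferentiableAt h0).hasMFDerivAt
    have hfu : HasMFDerivAt (𝓡 4) (𝓡 2) f (u : X) (mfderiv (𝓡 4) (𝓡 2) f (u : X)) :=
      ((hf u).mdifferentiableAt h0).hasMFDerivAt
    have h1 : HasMFDerivAt (𝓡 4) (𝓡 2) (Subtype.val ∘ g) u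
        ((ContinuousLinearMap.id ℝ _).comp (mfderiv (𝓡 4) (𝓡 2) g u)) := hvalV.comp u hgu
    have h2 : HasMFDerivAt (𝓡 4) (𝓡 2) (Subtype.val ∘ g) u
        ((mfderiv (𝓡 4) (𝓡 2) f (u : X)).comp (ContinuousLinearMap.id ℝ _)) :=
      hfu.comp u hvalU
    have heq := h1.mfderiv.symm.trans h2.mfderiv
    intro w
    obtain ⟨v, hv⟩ := hW (f u) u.2 u rfl w
    refine ⟨v, ?_⟩
    have key : mfderiv (𝓡 4) (𝓡 2) g u v = mfderiv (𝓡 4) (𝓡 2) f (u : X) v :=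
      DFunLike.congr_fun heq v
    exact key.trans hv
  exact ehresmann_fibration_holds 4 2 U V g hg hprop hsurj

/-- **An SBLF is a surface bundle over each connected open set of regular values**: `f⁻¹(W) → W`
is a fibre bundle (in the tree's sense `IsFibreBundleWith`, Hatcher §4.2) with fibre the fibre
over any chosen `y₀ ∈ W` (Ehresmann over the preconnected base `W`; Baykur 2012, proof of Lemma 7:
the regular parts are `Σ`-bundles over the two discs). [cite: Baykur2012, Lemma 7]
[cite: BrockerJanichIDT1982, (8.12)] -/
theorem isFibreBundleWith_restrictPreimage (hf : ContMDiff (𝓡 4) (𝓡 2) ∞ f)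
    {W : Set (Metric.sphere (0 : EuclideanSpace ℝ (Fin 3)) 1)} (hWo : IsOpen W)
    (hWc : IsPreconnected W)
    (hW : ∀ y ∈ W, ∀ q, f q = y → Surjective (mfderiv (𝓡 4) (𝓡 2) f q))
    {y₀ : Metric.sphere (0 : EuclideanSpace ℝ (Fin 3)) 1} (hy₀ : y₀ ∈ W) :
    IsFibreBundleWith ↥(f ⁻¹' {y₀}) (W.restrictPreimage f) := by
  haveI : PreconnectedSpace ↥W := Subtype.preconnectedSpace hWc
  have hcont : Continuous (W.restrictPreimage f) := hf.continuous.restrictPreimage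
  have h := Literature.Geometry.Manifold.isFibreBundleWith_of_isLocallyTrivialFibration hcont
    (isLocallyTrivialFibration_restrictPreimage hf hWo hW) ⟨y₀, hy₀⟩
  refine isFibreBundleWith_of_fibre_homeomorph h ?_
  -- the fibre of the restriction over `y₀` is the fibre of `f` over `y₀`
  have hemb : Topology.IsEmbedding (fun z : ↥((W.restrictPreimage f) ⁻¹' {⟨y₀, hy₀⟩}) =>
      ((z : ↥(f ⁻¹' W)) : X)) :=
    Topology.IsEmbedding.subtypeVal.comp Topology.IsEmbedding.subtypeVal
  refine hemb.toHomeomorph.trans (Homeomorph.setCongr ?_)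
  ext x
  simp only [mem_range, mem_preimage, mem_singleton_iff]
  constructor
  · rintro ⟨z, rfl⟩
    have hz := z.2
    rw [mem_preimage, mem_singleton_iff, Subtype.ext_iff] at hz
    exact hz
  · intro hx
    have hxW : x ∈ f ⁻¹' W := by rw [mem_preimage, hx]; exact hy₀
    exact ⟨⟨⟨x, hxW⟩, by rw [mem_preimage, mem_singleton_iff, Subtype.ext_iff]; exact hx⟩, rfl⟩

end Ehresmann

/-! ### The differential of the node `z₁ z₂` away from the origin -/

section Node

/-- **The node is smooth** (a product of two `ℝ`-linear complex coordinates). [folklore] -/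
theorem contDiff_lefschetzNodeMap : ContDiff ℝ ∞ lefschetzNodeMap := by
  set z₁ : EuclideanSpace ℝ (Fin 4) →L[ℝ] ℂ :=
    Complex.equivRealProdCLM.symm.toContinuousLinearMap.comp
      ((EuclideanSpace.proj (𝕜 := ℝ) (0 : Fin 4)).prod (EuclideanSpace.proj (𝕜 := ℝ) (1 : Fin 4)))
    with hz₁
  set z₂ : EuclideanSpace ℝ (Fin 4) →L[ℝ] ℂ :=
    Complex.equivRealProdCLM.symm.toContinuousLinearMap.comp
      ((EuclideanSpace.proj (𝕜 := ℝ) (2 : Fin 4)).prod (EuclideanSpace.proj (𝕜 := ℝ) (3 : Fin 4)))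
    with hz₂
  have h1 : ∀ v, z₁ v = ⟨v 0, v 1⟩ := fun v ↦ by apply Complex.ext <;> simp [hz₁]
  have h2 : ∀ v, z₂ v = ⟨v 2, v 3⟩ := fun v ↦ by apply Complex.ext <;> simp [hz₂]
  have heq : lefschetzNodeMap = fun x ↦ z₁ x * z₂ x := funext fun x ↦ by
    simp [lefschetzNodeMap, h1, h2]
  rw [heq]
  exact z₁.contDiff.mul z₂.contDiff

/-- **The differential of the node**: `d(z₁ z₂)_x (w) = z₁(x) w₂ + z₂(x) w₁` with
`z₁ = x₀ + i x₁`, `z₂ = x₂ + i x₃` (product rule). [folklore] -/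
theorem fderiv_lefschetzNodeMap_apply (x w : EuclideanSpace ℝ (Fin 4)) :
    fderiv ℝ lefschetzNodeMap x w = ⟨x 0, x 1⟩ * ⟨w 2, w 3⟩ + ⟨x 2, x 3⟩ * ⟨w 0, w 1⟩ := by
  set z₁ : EuclideanSpace ℝ (Fin 4) →L[ℝ] ℂ :=
    Complex.equivRealProdCLM.symm.toContinuousLinearMap.comp
      ((EuclideanSpace.proj (𝕜 := ℝ) (0 : Fin 4)).prod (EuclideanSpace.proj (𝕜 := ℝ) (1 : Fin 4)))
    with hz₁
  set z₂ : EuclideanSpace ℝ (Fin 4) →L[ℝ] ℂ :=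
    Complex.equivRealProdCLM.symm.toContinuousLinearMap.comp
      ((EuclideanSpace.proj (𝕜 := ℝ) (2 : Fin 4)).prod (EuclideanSpace.proj (𝕜 := ℝ) (3 : Fin 4)))
    with hz₂
  have h1 : ∀ v, z₁ v = ⟨v 0, v 1⟩ := fun v ↦ by apply Complex.ext <;> simp [hz₁]
  have h2 : ∀ v, z₂ v = ⟨v 2, v 3⟩ := fun v ↦ by apply Complex.ext <;> simp [hz₂]
  have heq : lefschetzNodeMap = fun x ↦ z₁ x * z₂ x := funext fun x ↦ by
    simp [lefschetzNodeMap, h1, h2]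
  have hD : HasFDerivAt lefschetzNodeMap (z₁ x • z₂ + z₂ x • z₁) x := by
    rw [heq]
    exact z₁.hasFDerivAt.mul z₂.hasFDerivAt
  rw [hD.fderiv]
  change z₁ x • z₂ w + z₂ x • z₁ w = _
  rw [smul_eq_mul, smul_eq_mul, h1, h2, h1, h2]

/-- **The node is a submersion away from the origin**: `d(z₁ z₂)_x` is onto iff `x ≠ 0`
(`z₁ w₂ + z₂ w₁` takes every complex value as soon as `(z₁, z₂) ≠ 0`, and vanishes identically
at the origin).  So the origin is the only critical point of the node. [folklore] -/
theorem surjective_fderiv_lefschetzNodeMap_iff (x : EuclideanSpace ℝ (Fin 4)) :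
    Surjective (fderiv ℝ lefschetzNodeMap x) ↔ x ≠ 0 := by
  constructor
  · rintro hs rfl
    obtain ⟨w, hw⟩ := hs 1
    rw [fderiv_lefschetzNodeMap_apply] at hw
    simp [Complex.ext_iff] at hw
  · intro hx
    -- one of the two complex coordinates of `x` is nonzero
    have hne : (⟨x 0, x 1⟩ : ℂ) ≠ 0 ∨ (⟨x 2, x 3⟩ : ℂ) ≠ 0 := by
      by_contra hcon
      push Not at hcon
      obtain ⟨h01, h23⟩ := hcon
      rw [Complex.ext_iff] at h01 h23
      simp only [Complex.zero_re, Complex.zero_im] at h01 h23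
      apply hx
      ext i
      fin_cases i
      · exact h01.1
      · exact h01.2
      · exact h23.1
      · exact h23.2
    intro c
    rcases hne with h01 | h23
    · -- use the `z₂`-slot: `w = (0, 0, u)` with `u = c / z₁`
      set u : ℂ := c / ⟨x 0, x 1⟩ with hu
      refine ⟨WithLp.toLp 2 ![0, 0, u.re, u.im], ?_⟩
      rw [fderiv_lefschetzNodeMap_apply]
      have e1 : (⟨(WithLp.toLp 2 ![0, 0, u.re, u.im] : EuclideanSpace ℝ (Fin 4)) 2,
          (WithLp.toLp 2 ![0, 0, u.re, u.im] : EuclideanSpace ℝ (Fin 4)) 3⟩ : ℂ) = u := by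
        apply Complex.ext <;> simp
      have e2 : (⟨(WithLp.toLp 2 ![0, 0, u.re, u.im] : EuclideanSpace ℝ (Fin 4)) 0,
          (WithLp.toLp 2 ![0, 0, u.re, u.im] : EuclideanSpace ℝ (Fin 4)) 1⟩ : ℂ) = 0 := by
        apply Complex.ext <;> simp
      rw [e1, e2, mul_zero, add_zero, hu, mul_div_cancel₀ _ h01]
    · set u : ℂ := c / ⟨x 2, x 3⟩ with hu
      refine ⟨WithLp.toLp 2 ![u.re, u.im, 0, 0], ?_⟩
      rw [fderiv_lefschetzNodeMap_apply]
      have e1 : (⟨(WithLp.toLp 2 ![u.re, u.im, 0, 0] : EuclideanSpace ℝ (Fin 4)) 0,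
          (WithLp.toLp 2 ![u.re, u.im, 0, 0] : EuclideanSpace ℝ (Fin 4)) 1⟩ : ℂ) = u := by
        apply Complex.ext <;> simp
      have e2 : (⟨(WithLp.toLp 2 ![u.re, u.im, 0, 0] : EuclideanSpace ℝ (Fin 4)) 2,
          (WithLp.toLp 2 ![u.re, u.im, 0, 0] : EuclideanSpace ℝ (Fin 4)) 3⟩ : ℂ) = 0 := by
        apply Complex.ext <;> simp
      rw [e1, e2, mul_zero, zero_add, hu, mul_div_cancel₀ _ h23]

end Node

/-! ### Critical points in a Lefschetz chart -/

section NodeChart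

variable {H : Type*} [TopologicalSpace H] {I : ModelWithCorners ℝ (EuclideanSpace ℝ (Fin 4)) H}
  {Z : Type*} [TopologicalSpace Z] [ChartedSpace H Z]
  {EB HB : Type*} [NormedAddCommGroup EB] [NormedSpace ℝ EB] [TopologicalSpace HB]
  {IB : ModelWithCorners ℝ EB HB} {B : Type*} [TopologicalSpace B] [ChartedSpace HB B]
  {π : Z → B} {p : Z}

/-- **In a Lefschetz chart the only critical point is the centre.**  If `c` is a Lefschetz chart
of `π` at `p` (`π = ψ⁻¹ ∘ (z₁ z₂) ∘ φ` on the chart domain, `φ`, `ψ` smooth charts with smooth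
inverses), then for `q` in the chart domain `dπ_q` is onto iff `φ q ≠ 0`, i.e. iff `q ≠ p`: the
chart differentials are invertible and `d(z₁ z₂)` is onto exactly off the origin.  Hence
Lefschetz critical points are isolated points of the critical set (Gompf–Stipsicz 1999,
Def. 8.1.4; Etnyre–Fuller 2006, §2). [cite: GompfStipsiczGSM1999, Def. 8.1.4] -/
theorem LefschetzChart.surjective_mfderiv_iff (c : LefschetzChart I IB π p) {q : Z}
    (hq : q ∈ c.φ.source) : Surjective (mfderiv I IB π q) ↔ c.φ q ≠ 0 := by
  have hev : π =ᶠ[𝓝 q] (c.ψ.symm ∘ lefschetzNodeMap ∘ c.φ) :=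
    Filter.eventuallyEq_of_mem (c.φ.open_source.mem_nhds hq) fun _ hx ↦ c.apply_eq hx
  have hφd : c.φ.MDifferentiable I (𝓡 4) :=
    ⟨c.contMDiffOn.mdifferentiableOn (by simp), c.contMDiffOn_symm.mdifferentiableOn (by simp)⟩
  have hψd : c.ψ.MDifferentiable IB 𝓘(ℝ, ℂ) :=
    ⟨c.contMDiffOn_base.mdifferentiableOn (by simp),
      c.contMDiffOn_base_symm.mdifferentiableOn (by simp)⟩
  have hmem : lefschetzNodeMap (c.φ q) ∈ c.ψ.target := by
    rw [← c.node_eq q hq]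
    exact c.ψ.map_source (c.mapsTo hq)
  have hmem' : lefschetzNodeMap (c.φ q) ∈ c.ψ.symm.source := by simpa using hmem
  have hφq : HasMFDerivAt I (𝓡 4) c.φ q (mfderiv I (𝓡 4) c.φ q) :=
    (hφd.mdifferentiableAt hq).hasMFDerivAt
  have hnode : HasMFDerivAt (𝓡 4) 𝓘(ℝ, ℂ) lefschetzNodeMap (c.φ q)
      (fderiv ℝ lefschetzNodeMap (c.φ q)) :=
    hasMFDerivAt_iff_hasFDerivAt.mpr
      ((contDiff_lefschetzNodeMap.differentiable (by simp)) _).hasFDerivAt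
  have hψq : HasMFDerivAt 𝓘(ℝ, ℂ) IB c.ψ.symm (lefschetzNodeMap (c.φ q))
      (mfderiv 𝓘(ℝ, ℂ) IB c.ψ.symm (lefschetzNodeMap (c.φ q))) :=
    (hψd.symm.mdifferentiableAt hmem').hasMFDerivAt
  have hcomp := hψq.comp q (hnode.comp q hφq)
  rw [hev.mfderiv_eq, hcomp.mfderiv, ← surjective_fderiv_lefschetzNodeMap_iff]
  have hA := hψd.symm.mfderiv_bijective hmem'
  have hC := hφd.mfderiv_bijective hq
  constructor
  · intro hs w
    obtain ⟨v, hv⟩ := hs (mfderiv 𝓘(ℝ, ℂ) IB c.ψ.symm (lefschetzNodeMap (c.φ q)) w)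
    exact ⟨mfderiv I (𝓡 4) c.φ q v, hA.1 hv⟩
  · intro hs
    exact hA.2.comp (hs.comp hC.2)

/-- **The centre is the only critical point in a Lefschetz chart**: a critical point of `π` in
the chart domain is the centre `p`. [folklore] -/
theorem LefschetzChart.eq_of_not_surjective_mfderiv (c : LefschetzChart I IB π p) {q : Z}
    (hq : q ∈ c.φ.source) (hπ : ¬ Surjective (mfderiv I IB π q)) : q = p := by
  have h0 : c.φ q = 0 := by
    by_contra hne
    exact hπ ((c.surjective_mfderiv_iff hq).2 hne)
  exact c.φ.injOn hq c.mem_source (h0.trans c.apply_eq_zero.symm)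

end NodeChart

/-! ### The critical locus of a simplified broken Lefschetz fibration -/

namespace IsSimplifiedBrokenLefschetzFibration

variable {X : Type u} [TopologicalSpace X] [ChartedSpace (EuclideanSpace ℝ (Fin 4)) X]
  [IsManifold (𝓡 4) ∞ X] {o : SmoothOrientation (𝓡 4) X}
  {f : X → Metric.sphere (0 : EuclideanSpace ℝ (Fin 3)) 1} {L : Finset X} {h : ℕ}

/-- **The critical set of an SBLF is closed** (the submersive locus of the `C^∞` map `f` is
open). [cite: HirschDT1976, Ch. 1 §3] -/
theorem isClosed_setOf_not_surjective (hf : IsSimplifiedBrokenLefschetzFibration o f L h) :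
    IsClosed {p : X | ¬ Surjective (mfderiv (𝓡 4) (𝓡 2) f p)} :=
  isClosed_setOf_not_surjective_mfderiv_of_contMDiff hf.contMDiff

/-- **Lefschetz points of an SBLF are isolated in the critical set**: every `p ∈ L` has an open
neighbourhood in which `p` is the only critical point of `f` (the domain of a Lefschetz chart).
[cite: GompfStipsiczGSM1999, Def. 8.1.4] -/
theorem exists_isOpen_forall_eq_of_mem (hf : IsSimplifiedBrokenLefschetzFibration o f L h)
    {p : X} (hp : p ∈ L) :
    ∃ V : Set X, IsOpen V ∧ p ∈ V ∧
      ∀ q ∈ V, ¬ Surjective (mfderiv (𝓡 4) (𝓡 2) f q) → q = p := by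
  obtain ⟨c, -⟩ := hf.lefschetz p hp
  exact ⟨c.φ.source, c.φ.open_source, c.mem_source,
    fun q hq hπ ↦ c.eq_of_not_surjective_mfderiv hq hπ⟩

/-- **The round locus of an SBLF is closed**: it is the critical set minus the finitely many
isolated Lefschetz points. [folklore] -/
theorem isClosed_round (hf : IsSimplifiedBrokenLefschetzFibration o f L h) :
    IsClosed ({p : X | ¬ Surjective (mfderiv (𝓡 4) (𝓡 2) f p)} \ (↑L : Set X)) := by
  choose V hVo hpV hV using fun p : ↥L ↦ hf.exists_isOpen_forall_eq_of_mem p.2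
  have hrepr : {p : X | ¬ Surjective (mfderiv (𝓡 4) (𝓡 2) f p)} \ (↑L : Set X) =
      {p : X | ¬ Surjective (mfderiv (𝓡 4) (𝓡 2) f p)} ∩ (⋃ p : ↥L, V p)ᶜ := by
    ext z
    simp only [mem_sdiff, mem_setOf_eq, Finset.mem_coe, mem_inter_iff, mem_compl_iff, mem_iUnion,
      not_exists]
    constructor
    · rintro ⟨hz, hzL⟩
      refine ⟨hz, fun p hzp ↦ hzL ?_⟩
      rw [hV p z hzp hz]
      exact p.2
    · rintro ⟨hz, hzV⟩
      exact ⟨hz, fun hzL ↦ hzV ⟨z, hzL⟩ (hpV ⟨z, hzL⟩)⟩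
  rw [hrepr]
  exact hf.isClosed_setOf_not_surjective.inter
    (isOpen_iUnion fun p ↦ hVo p).isClosed_compl

/-- **The round locus of an SBLF on a compact manifold is compact.** [folklore] -/
theorem isCompact_round [CompactSpace X] (hf : IsSimplifiedBrokenLefschetzFibration o f L h) :
    IsCompact ({p : X | ¬ Surjective (mfderiv (𝓡 4) (𝓡 2) f p)} \ (↑L : Set X)) :=
  hf.isClosed_round.isCompact

/-- **The round image of an SBLF is connected** (image of the connected round locus; with
`injOn_crit` it is an embedded circle, Baykur–Kamada 2015, §3). [cite: BaykurKamada2015, §3] -/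
theorem isConnected_image_round (hf : IsSimplifiedBrokenLefschetzFibration o f L h) :
    IsConnected (f '' ({p : X | ¬ Surjective (mfderiv (𝓡 4) (𝓡 2) f p)} \ (↑L : Set X))) :=
  hf.isConnected_round.image f hf.contMDiff.continuous.continuousOn

/-- **The round image of an SBLF on a compact manifold is compact.** [folklore] -/
theorem isCompact_image_round [CompactSpace X]
    (hf : IsSimplifiedBrokenLefschetzFibration o f L h) :
    IsCompact (f '' ({p : X | ¬ Surjective (mfderiv (𝓡 4) (𝓡 2) f p)} \ (↑L : Set X))) :=
  hf.isCompact_round.image hf.contMDiff.continuous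

/-- **The regular values of an SBLF are the complement of the critical image.** [folklore] -/
theorem setOf_regularValue_eq (hf : IsSimplifiedBrokenLefschetzFibration o f L h) :
    {y | ∀ q, f q = y → Surjective (mfderiv (𝓡 4) (𝓡 2) f q)} =
      (f '' {p : X | ¬ Surjective (mfderiv (𝓡 4) (𝓡 2) f p)})ᶜ := by
  have _ := hf
  ext y
  simp only [mem_setOf_eq, mem_compl_iff, mem_image, not_exists, not_and]
  constructor
  · exact fun hy q hq hfq ↦ hq (hy q hfq)
  · intro hy q hfq
    by_contra hq
    exact hy q hq hfq

/-- **The critical image of an SBLF is the round image together with the finitely many Lefschetz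
values.** [folklore] -/
theorem image_setOf_not_surjective_eq (hf : IsSimplifiedBrokenLefschetzFibration o f L h) :
    f '' {p : X | ¬ Surjective (mfderiv (𝓡 4) (𝓡 2) f p)} =
      f '' ({p : X | ¬ Surjective (mfderiv (𝓡 4) (𝓡 2) f p)} \ (↑L : Set X)) ∪
        f '' (↑L : Set X) := by
  rw [← image_union]
  congr 1
  ext p
  simp only [mem_setOf_eq, mem_union, mem_sdiff, Finset.mem_coe]
  constructor
  · intro hp
    by_cases hpL : p ∈ L
    · exact Or.inr hpL
    · exact Or.inl ⟨hp, hpL⟩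
  · rintro (⟨hp, -⟩ | hpL)
    · exact hp
    · exact hf.not_surjective_mfderiv_of_mem hpL

/-- **The regular values of an SBLF on a compact manifold form an open set** (the critical set
is compact, so the critical image is closed). [folklore] -/
theorem isOpen_setOf_regularValue [CompactSpace X]
    (hf : IsSimplifiedBrokenLefschetzFibration o f L h) :
    IsOpen {y | ∀ q, f q = y → Surjective (mfderiv (𝓡 4) (𝓡 2) f q)} := by
  rw [hf.setOf_regularValue_eq, isOpen_compl_iff]
  exact (hf.isClosed_setOf_not_surjective.isCompact.image hf.contMDiff.continuous).isClosed

/-- **A regular fibre of an SBLF on a closed 4-manifold is an embedded closed connected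
surface**: for a regular value `y` there are a compact connected `C^∞` surface `F` without
boundary (Hausdorff, second countable) and a `C^∞` embedding `e : F → X` with
`range e = f⁻¹(y)` (the regular value theorem, Hirsch 1976, Ch. 1 §3 Thm. 3.2, with compactness
of the closed fibre and the connectedness clause of `IsSimplifiedBrokenLefschetzFibration.fibre`).
This is the surface whose genus the fibre clauses read homologically.
[cite: HirschDT1976, Ch. 1 §3 Thm. 3.2] -/
theorem exists_isSmoothEmbedding_range_eq_fibre [T2Space X] [SecondCountableTopology X]
    [CompactSpace X] (hf : IsSimplifiedBrokenLefschetzFibration o f L h)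
    {y : Metric.sphere (0 : EuclideanSpace ℝ (Fin 3)) 1}
    (hy : ∀ q, f q = y → Surjective (mfderiv (𝓡 4) (𝓡 2) f q)) :
    ∃ (F : Type u) (_ : TopologicalSpace F) (_ : T2Space F) (_ : SecondCountableTopology F)
      (_ : CompactSpace F) (_ : ConnectedSpace F) (_ : ChartedSpace (EuclideanSpace ℝ (Fin 2)) F)
      (_ : IsManifold (𝓡 2) ∞ F) (e : F → X),
      Manifold.IsSmoothEmbedding (𝓡 2) (𝓡 4) ∞ e ∧ range e = f ⁻¹' {y} := by
  obtain ⟨F, _, _, _, _, _, e, he, hre⟩ :=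
    exists_isSmoothEmbedding_range_eq_preimage (n := 4) (m := 2) (k := 2) rfl hf.contMDiff hy
  have hcpt : IsCompact (range e) :=
    hre ▸ (isClosed_singleton.preimage hf.contMDiff.continuous).isCompact
  haveI : CompactSpace F := by
    rw [← isCompact_univ_iff, he.isEmbedding.isInducing.isCompact_iff, image_univ]
    exact hcpt
  have hconn : IsConnected (range e) := hre ▸ (hf.fibre y hy).1
  haveI : ConnectedSpace F := by
    rw [connectedSpace_iff_univ]
    refine ⟨?_, ?_⟩
    · obtain ⟨_, ⟨z, rfl⟩⟩ := hconn.nonempty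
      exact ⟨z, mem_univ z⟩
    · rw [← he.isEmbedding.isInducing.isPreconnected_image, image_univ]
      exact hconn.isPreconnected
  exact ⟨F, inferInstance, inferInstance, inferInstance, inferInstance, inferInstance,
    inferInstance, inferInstance, e, he, hre⟩

/-- **A regular fibre of an SBLF on a closed oriented 4-manifold is a closed connected orientable
surface, with `χ = 2 - rank H₁`**: for a regular value `y` there are a compact connected
smoothly orientable `C^∞` surface `F` without boundary (Hausdorff, second countable), a smooth
topological embedding `e : F → X` with `range e = f⁻¹(y)`, a homeomorphism `F ≃ₜ f⁻¹(y)`, and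
`H_•(F; ℤ)` is finitely generated, zero from degree `3` on, with
`χ(F) = 2 - rank H₁(f⁻¹(y); ℤ)` — so `χ(F) = 2 - 2(h + 1)` or `2 - 2h` according to the genus
clause of `IsSimplifiedBrokenLefschetzFibration.fibre` (the fibre genera entering Baykur 2012,
Lemma 7: `e(X) = 2 - 2(g - 1) + 2 - 2g + k`). [cite: Baykur2012, Lemma 7]
[cite: HirschDT1976, Ch. 1 §3 Thm. 3.2 and §4.4] [cite: HatcherAT2002, Thm. 3.26 (a)] -/
theorem exists_oriented_surface_fibre [T2Space X] [SecondCountableTopology X] [CompactSpace X]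
    (hf : IsSimplifiedBrokenLefschetzFibration o f L h)
    {y : Metric.sphere (0 : EuclideanSpace ℝ (Fin 3)) 1}
    (hy : ∀ q, f q = y → Surjective (mfderiv (𝓡 4) (𝓡 2) f q)) :
    ∃ (F : Type u) (_ : TopologicalSpace F) (_ : T2Space F) (_ : SecondCountableTopology F)
      (_ : CompactSpace F) (_ : ConnectedSpace F) (_ : ChartedSpace (EuclideanSpace ℝ (Fin 2)) F)
      (_ : IsManifold (𝓡 2) ∞ F) (e : F → X) (φ : F ≃ₜ ↥(f ⁻¹' {y})),
      ContMDiff (𝓡 2) (𝓡 4) ∞ e ∧ Topology.IsEmbedding e ∧ range e = f ⁻¹' {y} ∧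
        (∀ w, (φ w : X) = e w) ∧ IsOrientable (𝓡 2) F ∧ FinRelHomology ℤ ℤ F ∅ 3 ∧
        relEuler ℤ ℤ F ∅ =
          2 - (Module.finrank ℤ (singularHomology ℤ ℤ ↥(f ⁻¹' {y}) 1) : ℤ) := by
  obtain ⟨F, _, _, _, _, _, e, hes, heemb, hrange, hor⟩ :=
    exists_orientable_surface_range_eq_preimage hf.contMDiff hy
  have hF : IsOrientable (𝓡 2) F := hor ⟨o⟩
  have hcpt : IsCompact (range e) :=
    hrange ▸ (isClosed_singleton.preimage hf.contMDiff.continuous).isCompact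
  haveI : CompactSpace F := by
    rw [← isCompact_univ_iff, heemb.isInducing.isCompact_iff, image_univ]
    exact hcpt
  have hconn : IsConnected (range e) := hrange ▸ (hf.fibre y hy).1
  haveI : ConnectedSpace F := by
    rw [connectedSpace_iff_univ]
    refine ⟨?_, ?_⟩
    · obtain ⟨_, ⟨z, rfl⟩⟩ := hconn.nonempty
      exact ⟨z, mem_univ z⟩
    · rw [← heemb.isInducing.isPreconnected_image, image_univ]
      exact hconn.isPreconnected
  let φ : F ≃ₜ ↥(f ⁻¹' {y}) := heemb.toHomeomorph.trans (Homeomorph.setCongr hrange)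
  obtain ⟨hfin, hχ⟩ := finRelHomology_and_relEuler_of_isOrientable_surface F hF
  refine ⟨F, inferInstance, inferInstance, inferInstance, inferInstance, inferInstance,
    inferInstance, inferInstance, e, φ, hes, heemb, hrange, fun w => rfl, hF, hfin, ?_⟩
  rw [hχ, (singularHomology.mapIso ℤ ℤ φ 1).toLinearEquiv.finrank_eq]

end IsSimplifiedBrokenLefschetzFibration

end Literature.Topology.FourManifolds

end
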